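import Summits.CriticalPhenomena.PercolationContinuityZ3.Theorems.Transplant.SkelPhiFaceNegBTC1
import Summits.CriticalPhenomena.PercolationContinuityZ3.Theorems.Transplant.SkelNegBParamsFaceA
import Summits.CriticalPhenomena.PercolationContinuityZ3.Theorems.Transplant.SkelNegBParamsSlotsSUA
import Summits.CriticalPhenomena.PercolationContinuityZ3.Theorems.Transplant.SkelNegBParamsResidualsA
import Summits.CriticalPhenomena.PercolationContinuityZ3.Theorems.Transplant.SkelNegBParamsRootA
import Summits.CriticalPhenomena.PercolationContinuityZ3.Theorems.Transplant.SkelNegBParamsKitFloors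
import Summits.CriticalPhenomena.PercolationContinuityZ3.Theorems.Transplant.SkelPhiFaceSlots2
import Summits.CriticalPhenomena.PercolationContinuityZ3.Theorems.Transplant.SkelNegBParamsBridgeF
import Summits.CriticalPhenomena.PercolationContinuityZ3.Theorems.Transplant.SkelNegBParamsSchedA
import Summits.CriticalPhenomena.PercolationContinuityZ3.Theorems.Transplant.SkelPhiRootNegBKit
import Summits.CriticalPhenomena.PercolationContinuityZ3.Theorems.Transplant.SkelPhiVLineServe
import Summits.CriticalPhenomena.PercolationContinuityZ3.Theorems.Transplant.SkelNegBParamsRootK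
import Summits.CriticalPhenomena.PercolationContinuityZ3.Theorems.Transplant.SkelNegBParamsSlotsT
import Summits.CriticalPhenomena.PercolationContinuityZ3.Theorems.Transplant.SkelNegBParamsFaceRoomsA
import Summits.CriticalPhenomena.PercolationContinuityZ3.Theorems.Transplant.SkelNegBParamsFaceLatA
import Summits.CriticalPhenomena.PercolationContinuityZ3.Theorems.Transplant.SkelPhiFaceChainFactL
import Summits.CriticalPhenomena.PercolationContinuityZ3.Theorems.Transplant.SkelNegBParamsLFA
import Summits.CriticalPhenomena.PercolationContinuityZ3.Theorems.Transplant.SkelPhiRootServe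
import Summits.CriticalPhenomena.PercolationContinuityZ3.Theorems.Transplant.SkelPhiRootServeTable
import Summits.CriticalPhenomena.PercolationContinuityZ3.Theorems.Transplant.SkelNegBParamsExcess
import Summits.CriticalPhenomena.PercolationContinuityZ3.Theorems.Transplant.SkelNegBChoiceAllTA
import Summits.CriticalPhenomena.PercolationContinuityZ3.Theorems.Transplant.SkelPhiCylRadOri
import HarnessLib

/-!
# N1 ({±1} node), (F) column — THE WRAPPER'S LAYER (b), part B2 (hp-8 g36): `NegB.faceOblRM_negBTC₂` — layer (a) v7 (`faceOblRM_negBTC₁`) AT THE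
# SLOTS OF RECORD `gv := KS.gT 0 gx`, `fv := KS.fT 0 fx`, `Sv := SUA ex mx`, `Pv := KS.PR 0 Px` (slot-ledger ζ′ v1; `ex`, `mx`, `gx`, `fx`, `Px` GENERAL with the
# two floors `hex : exA ≤ ex ∧ r₀A (R (scale M_BF n_BF)) + 1 ≤ ex` and `hmx : prFA.mF fcellsA ≤ mx` as hypotheses), kit index `mk := 0`, bridge prism radius
# `Rb := R (scale t M_BF n_BF)` (stmt-g16's wide pair B_F, column `cF`), kit radius `r := L′(SUA ex mx)`, face diameter `m := mRA mx`, contact band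
# `E := RlevA + reachA`, WITH THESE GROUPS DISCHARGED: the schedule/slot facts (`hgap… hoff hoffN hgapR hr₀L`: SlotsSUA/SchedA), levels/counts/frame rooms
# (`Rlev N M hRlev… aw k₀ kF hk₀… hroomF hkF haw hcount nFc hnC hU3 kb η nB`, p1-g13's part-1 discharges and lemmas `hRlev_RA`/`nFc_RA` (FaceRoomsA), credited),
# the scheme excess (`R₁ hR₁ hdiam` at `mRA mx`: `hR₁_UA`, `hdiam_mF` + `hmx`), the radii (`hRlr hr₁R hr₂R hRsr hRb₀ hRr₀ hR₁b hR₁r hρr` from `floors_exA`, `Lp_SUA_eq`,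
# `Rex_mono`), the twelve run-box widths and the reaches (`rootKit_levels/_reach`, p3's SkelPhiRootNegBKit), the zone clearance and the zone inside the long
# prism (`KS.hclrz_T`; `fatSeq_subset_pgramPrismFin` with `R = ψ` from `FactsO.seed`), the face table (`C := 2M_u+12`, `k_L := M_u+4` at `M_K = 24M_u+63`:
# `KS.MK_facts/nKit_facts/layerK_of_atQOS`, `cL_upperA/cL_lowerA`), the δ₂-counts and the face exits (`real_pexVL_gt` on `pexFO`).
# LEFT for part B3: `hnL hvL hlay`, the bridge family and its case data (`B hB σhF hσhF qB qB₃ hRl₁ hB0 hπ1 hclr₁ hwideb hdwb hDwb hEb Qb Fb hQb hFb hFZ hbridge`),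
# the F-Λ values (`Λ₀ Λ₁ kA hΛR hΛQ0 hΛQ1 hΛZ hkA0 hkA1`, stmt's FaceLamA), the per-centre floors (`numsX numsY hnFx hnFy`, stmt's FaceFloorsXA/YA), `hCF`.
builds on p205010 (kernel theorem, internal audit signed; external expert review pending) — nothing in this file uses p205010; no claim about the open node.
Lane `prim-bschramm`, seat `prim-hp-8` (gen 36); helper file (`--supports stmt-CriticalPhenomena-4575 --as helper`); generated by HOME prim-hp-8/code/gen36/gen_btb2.py.
* **`NegB.faceOblRM_negBTC₂`**.
[cite: KozmaNitzan2024, §4 Lemma 10 (pp. 17–21), Lemma 12 (pp. 23–25), Theorem 6 (pp. 25–31)] [cite: MartineauTassion2017, §4.3 Lemma 4.2]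
v9 note: v9 (hp-8 g36, 2026-08-22 09:15Z): the y′-face numbers and kit rooms read their OWN half-widths `qB′ qB₃′` (level-units landing half-width, α-units x-run start half-width) — v8 shared `qB qB₃` with the x-face (α-units landing, level-units y′-run start `≥ W ≈ n_Lℓ_L/U`), a units mismatch that breaks the y′-face floors FT5/FT6/FL1/FL2 when `ℓ_L ≫ Kq·n_L`.
-/

noncomputable section

open scoped Classical ENNReal

namespace Summit.CriticalPhenomena.PercolationContinuityZ3.Theorems.Transplant

namespace PlanarSkeletonNeg

namespace NegB

open MeasureTheory Literature.Probability.Percolation Literature.Probability.LatticeModels SimpleGraph KNCells KNLevels GadgetSystem Contour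
open Literature.Probability.Percolation.KozmaNitzan
open Literature.Probability.Percolation.KozmaNitzan.Cells (oth sgOf sgOf_sign stepVec_apply_fst)
open Literature.Barriers.CriticalPhenomena (graphBall mem_graphBall_self graphBall_mono)
open BoxProdZ2 (ConcRadiiG Erad Frad nQ nS)
open ChainPlanar ChainPara
open Skel (winGraph routeW excess WinStepData)
open SkelI (tanOff)
open TwoAxis.Para (modulus detD rep₂)
open SkelConc (Consts)
open Skelφ
open Neg

variable {κ : Consts} {V : Type} [DecidableEq V] [Countable V] {G : SimpleGraph V} [G.LocallyFinite] {Φ : PlanarSkeletonNeg G} {t : V}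
  {p : unitInterval} {gv fv : Neg.FSlot} {Sv : SSlot} {hC : Φ.CylSubcritical p} {Pv : PSlot} {O : Skelφ.StepI.OutO V} {q : unitInterval}

/-- Face-table arithmetic (raw exit): `((M+1)D + 1) + 2D ≤ (2M+12)·D` for `D > 0`. [folklore] -/
private theorem faceTable_arithR (Mu : ℕ) (D : ℤ) (hD : 0 < D) : (((Mu + 1 : ℕ) : ℤ) * D + 1) + 2 * D ≤ ((2 * Mu + 12 : ℕ) : ℤ) * D := by
  push_cast; nlinarith

/-- Face-table arithmetic (level exit): `((M+1)D + 1) + cl + D ≤ (M+4)·D` when `cl ≤ cL ≤ D − 2`. [folklore] -/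
private theorem faceTable_arithL (Mu : ℕ) (D cl cL : ℤ) (hD : 0 < D) (h1 : cl ≤ cL) (h2 : cL + 2 ≤ D) :
    (((Mu + 1 : ℕ) : ℤ) * D + 1) + cl + D ≤ (((Mu : ℕ) : ℤ) + 4) * D := by
  push_cast; nlinarith

/-- Face-table arithmetic (climb room): `(M+5)·D ≤ (2M+12)·cL` when `11D < 13cL`, `D > 0`. [folklore] -/
private theorem faceTable_arithC (Mu : ℕ) (D cL : ℤ) (hD : 0 < D) (h1 : 11 * D < 13 * cL) :
    ((((Mu : ℕ) : ℤ) + 4) + 1) * D ≤ ((2 * Mu + 12 : ℕ) : ℤ) * cL := by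
  push_cast; nlinarith

set_option maxHeartbeats 1600000 in
/-- **Layer (b), part B2 of the (F) wrapper** (see the module docstring). [cite: KozmaNitzan2024, §4 Lemma 10 (pp. 17–21), Lemma 12 (pp. 23–25)] -/
theorem faceOblRM_negBTC₂ (cF : ℕ) (gx fx : Neg.FSlot) (Px : PSlot) (ex mx : GSlot)
    (hAt : (choiceAtOTA κ Φ t p (KS.gT 0 gx) (KS.fT 0 fx) (SUA ex mx) hC (KS.PR 0 Px)).AtQO O q)
    (hmx : (prFA κ Φ t p O.merged (gOf κ Φ t p O (KS.gT 0 gx)) (fOf κ Φ t p O (KS.fT 0 fx))).mF (fcellsA κ Φ t p O.merged (gOf κ Φ t p O (KS.gT 0 gx)) (fOf κ Φ t p O (KS.fT 0 fx))) ≤ ((mx κ Φ t p O.merged (gOf κ Φ t p O (KS.gT 0 gx)) (fOf κ Φ t p O (KS.fT 0 fx)) : ℕ) : ℤ))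
    (hex : exA κ Φ t p O.merged (gOf κ Φ t p O (KS.gT 0 gx)) (fOf κ Φ t p O (KS.fT 0 fx)) ≤ ex κ Φ t p O.merged (gOf κ Φ t p O (KS.gT 0 gx)) (fOf κ Φ t p O (KS.fT 0 fx)) ∧
      KS.r₀A Φ t O.merged 0 (O.merged.R (O.merged.scale t (KS.MBF κ Φ t p O.merged cF 0) (KS.nBF κ Φ t p O.merged cF 0))) + 1 ≤ ex κ Φ t p O.merged (gOf κ Φ t p O (KS.gT 0 gx)) (fOf κ Φ t p O (KS.fT 0 fx)))  (h1 : Φ.types = {t}) (hp0 : 0 < (p : ℝ)) (hp1 : (p : ℝ) < 1)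
          (hnL : 1 ≤ (nL κ Φ t p O.merged (gOf κ Φ t p O (KS.gT 0 gx)) (fOf κ Φ t p O (KS.fT 0 fx)))) (hvL : |(prFA κ Φ t p O.merged (gOf κ Φ t p O (KS.gT 0 gx)) (fOf κ Φ t p O (KS.fT 0 fx))).vα| ≤ (nL κ Φ t p O.merged (gOf κ Φ t p O (KS.gT 0 gx)) (fOf κ Φ t p O (KS.fT 0 fx))))
    (B : ℤ → BridgePrm) (hB : ∀ σ' : ℤ, σ' = 1 ∨ σ' = -1 → BridgeOK (B σ')) (σhF : MDir → ℤ) (hσhF : ∀ du : MDir, σhF du = 1 ∨ σhF du = -1)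
     (qB qB₃ qB' qB₃' : ℕ)
    (hlay : ((nL κ Φ t p O.merged (gOf κ Φ t p O (KS.gT 0 gx)) (fOf κ Φ t p O (KS.fT 0 fx))) + (prFA κ Φ t p O.merged (gOf κ Φ t p O (KS.gT 0 gx)) (fOf κ Φ t p O (KS.fT 0 fx))).h.natAbs : ℕ) ≤ ((nL κ Φ t p O.merged (gOf κ Φ t p O (KS.gT 0 gx)) (fOf κ Φ t p O (KS.fT 0 fx))) : ℤ) * (ℓL κ Φ t p O.merged (gOf κ Φ t p O (KS.gT 0 gx)) (fOf κ Φ t p O (KS.fT 0 fx))) + 1)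
    (hRl₁ : ∀ σ' : ℤ, σ' = 1 ∨ σ' = -1 → (KS.RlevA κ Φ t p O.merged 0) + 1 ≤ (B σ').R')
    (hB0 : ∀ σ' : ℤ, σ' = 1 ∨ σ' = -1 → Finset.Icc (Skelφ.pt (nL κ Φ t p O.merged (gOf κ Φ t p O (KS.gT 0 gx)) (fOf κ Φ t p O (KS.fT 0 fx))) (σ' * (prFA κ Φ t p O.merged (gOf κ Φ t p O (KS.gT 0 gx)) (fOf κ Φ t p O (KS.fT 0 fx))).h)) (Skelφ.pt (nL κ Φ t p O.merged (gOf κ Φ t p O (KS.gT 0 gx)) (fOf κ Φ t p O (KS.fT 0 fx))) (σ' * (prFA κ Φ t p O.merged (gOf κ Φ t p O (KS.gT 0 gx)) (fOf κ Φ t p O (KS.fT 0 fx))).h + (ℓL κ Φ t p O.merged (gOf κ Φ t p O (KS.gT 0 gx)) (fOf κ Φ t p O (KS.fT 0 fx))))) ⊆ Finset.Icc (B σ').B₀lo (B σ').B₀hi)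
    {Λ₀ Λ₁ : ℤ} {kA : Fin 2 → ℤ}
    (hΛR : ∀ σ' : ℤ, σ' = 1 ∨ σ' = -1 → ∀ x ∈ Finset.Icc (B σ').regionLo (B σ').regionHi, |(prFA κ Φ t p O.merged (gOf κ Φ t p O (KS.gT 0 gx)) (fOf κ Φ t p O (KS.fT 0 fx))).vβ * (σ' * x 0) - (prFA κ Φ t p O.merged (gOf κ Φ t p O (KS.gT 0 gx)) (fOf κ Φ t p O (KS.fT 0 fx))).vα * x 1| ≤ Λ₀ ∧ |((nL κ Φ t p O.merged (gOf κ Φ t p O (KS.gT 0 gx)) (fOf κ Φ t p O (KS.fT 0 fx))) : ℤ) * x 1 - (prFA κ Φ t p O.merged (gOf κ Φ t p O (KS.gT 0 gx)) (fOf κ Φ t p O (KS.fT 0 fx))).h * (σ' * x 0)| ≤ Λ₁)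
    (hΛQ0 : modulus (nL κ Φ t p O.merged (gOf κ Φ t p O (KS.gT 0 gx)) (fOf κ Φ t p O (KS.fT 0 fx))) (prFA κ Φ t p O.merged (gOf κ Φ t p O (KS.gT 0 gx)) (fOf κ Φ t p O (KS.fT 0 fx))).h (prFA κ Φ t p O.merged (gOf κ Φ t p O (KS.gT 0 gx)) (fOf κ Φ t p O (KS.fT 0 fx))).vα (prFA κ Φ t p O.merged (gOf κ Φ t p O (KS.gT 0 gx)) (fOf κ Φ t p O (KS.fT 0 fx))).vβ + ((nL κ Φ t p O.merged (gOf κ Φ t p O (KS.gT 0 gx)) (fOf κ Φ t p O (KS.fT 0 fx))) : ℤ) * ((3 * (ℓL κ Φ t p O.merged (gOf κ Φ t p O (KS.gT 0 gx)) (fOf κ Φ t p O (KS.fT 0 fx))) : ℕ) : ℤ) ≤ Λ₀) (hΛQ1 : ((nL κ Φ t p O.merged (gOf κ Φ t p O (KS.gT 0 gx)) (fOf κ Φ t p O (KS.fT 0 fx))) : ℤ) * ((3 * (ℓL κ Φ t p O.merged (gOf κ Φ t p O (KS.gT 0 gx)) (fOf κ Φ t p O (KS.fT 0 fx))) : ℕ)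 : ℤ) ≤ Λ₁)
    (hΛZ : (|(prFA κ Φ t p O.merged (gOf κ Φ t p O (KS.gT 0 gx)) (fOf κ Φ t p O (KS.fT 0 fx))).vβ| + |(prFA κ Φ t p O.merged (gOf κ Φ t p O (KS.gT 0 gx)) (fOf κ Φ t p O (KS.fT 0 fx))).vα|) * ((Mu O.merged) : ℤ) ≤ Λ₀ ∧ (((nL κ Φ t p O.merged (gOf κ Φ t p O (KS.gT 0 gx)) (fOf κ Φ t p O (KS.fT 0 fx))) : ℤ) + |(prFA κ Φ t p O.merged (gOf κ Φ t p O (KS.gT 0 gx)) (fOf κ Φ t p O (KS.fT 0 fx))).h|) * ((Mu O.merged) : ℤ) ≤ Λ₁)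
    (hkA0 : (prFA κ Φ t p O.merged (gOf κ Φ t p O (KS.gT 0 gx)) (fOf κ Φ t p O (KS.fT 0 fx))).c₀ * (|(prFA κ Φ t p O.merged (gOf κ Φ t p O (KS.gT 0 gx)) (fOf κ Φ t p O (KS.fT 0 fx))).A| * Λ₀) ≤ kA 0 * (prFA κ Φ t p O.merged (gOf κ Φ t p O (KS.gT 0 gx)) (fOf κ Φ t p O (KS.fT 0 fx))).D) (hkA1 : (prFA κ Φ t p O.merged (gOf κ Φ t p O (KS.gT 0 gx)) (fOf κ Φ t p O (KS.fT 0 fx))).c₁ * (|(prFA κ Φ t p O.merged (gOf κ Φ t p O (KS.gT 0 gx)) (fOf κ Φ t p O (KS.fT 0 fx))).A| * Λ₁) ≤ kA 1 * (prFA κ Φ t p O.merged (gOf κ Φ t p O (KS.gT 0 gx)) (fOf κ Φ t p O (KS.fT 0 fx))).D)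
      (hπ1 : ∀ σ' : ℤ, σ' = 1 ∨ σ' = -1 → ((B σ').core1Lo 0).natAbs + ((B σ').core1Lo 1).natAbs ≤ (Skelφ.Prm.Lp (SUA ex mx κ Φ t p O.merged (gOf κ Φ t p O (KS.gT 0 gx)) (fOf κ Φ t p O (KS.fT 0 fx)) q)))
    (hclr₁ : ∀ σ' : ℤ, σ' = 1 ∨ σ' = -1 → ((Mu O.merged : ℕ) : ℤ) < (B σ').B₀lo 0 - (B σ').R' - (B σ').pr)
       (hCF : ChainFactL NegB.LfA G Φ.Δ κ)
    (hwideb : ∀ σ' : ℤ, σ' = 1 ∨ σ' = -1 → ∀ j, (KS.j₀A t O.merged 0) ≤ j → j ≤ (KS.j₁A κ Φ t p O.merged 0) → ∀ i, ((B σ').B₀lo - (j : Site 2)) i + 2 * tanOff (KS.apron Φ t O.merged 0 (((Mu O.merged : ℕ) : ℤ) + 2) (KS.r₀A Φ t O.merged 0 (O.merged.R (O.merged.scale t (KS.MBF κ Φ t p O.merged cF 0) (KS.nBF κ Φ t p O.merged cF 0))))).ℓs (KS.apron Φ t O.merged 0 (((Mu O.merged : ℕ) : ℤ) + 2) (KS.r₀A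 Φ t O.merged 0 (O.merged.R (O.merged.scale t (KS.MBF κ Φ t p O.merged cF 0) (KS.nBF κ Φ t p O.merged cF 0))))).M ≤ ((B σ').B₀hi + (j : Site 2)) i)
    (hdwb : ∀ σ' : ℤ, σ' = 1 ∨ σ' = -1 → ∀ j, (KS.j₀A t O.merged 0) ≤ j → j ≤ (KS.j₁A κ Φ t p O.merged 0) → ∀ i, ((B σ').B₀lo - (j : Site 2)) i + ((KS.apron Φ t O.merged 0 (((Mu O.merged : ℕ) : ℤ) + 2) (KS.r₀A Φ t O.merged 0 (O.merged.R (O.merged.scale t (KS.MBF κ Φ t p O.merged cF 0) (KS.nBF κ Φ t p O.merged cF 0))))).d + 2 : ℕ) ≤ ((B σ').B₀hi + (j : Site 2)) i)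
    (hDwb : ∀ σ' : ℤ, σ' = 1 ∨ σ' = -1 → ∀ j, (KS.j₀A t O.merged 0) ≤ j → j ≤ (KS.j₁A κ Φ t p O.merged 0) → ∀ i, ((B σ').B₀lo - (j : Site 2)) i + ((shellD (KS.apron Φ t O.merged 0 (((Mu O.merged : ℕ) : ℤ) + 2) (KS.r₀A Φ t O.merged 0 (O.merged.R (O.merged.scale t (KS.MBF κ Φ t p O.merged cF 0) (KS.nBF κ Φ t p O.merged cF 0))))) + 1 + (KS.apron Φ t O.merged 0 (((Mu O.merged : ℕ) : ℤ) + 2) (KS.r₀A Φ t O.merged 0 (O.merged.R (O.merged.scale t (KS.MBF κ Φ t p O.merged cF 0) (KS.nBF κ Φ t p O.merged cF 0))))).d + (KS.KCmax t O.merged 0) + (KS.Rs t O.merged 0) : ℕ) : ℤ) ≤ ((B σ').B₀hi + (j : Site 2)) i)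
    (hEb : ∀ σ' : ℤ, σ' = 1 ∨ σ' = -1 → (KS.j₁A κ Φ t p O.merged 0) + ((KS.apron Φ t O.merged 0 (((Mu O.merged : ℕ) : ℤ) + 2) (KS.r₀A Φ t O.merged 0 (O.merged.R (O.merged.scale t (KS.MBF κ Φ t p O.merged cF 0) (KS.nBF κ Φ t p O.merged cF 0))))).N * (tanOff (KS.apron Φ t O.merged 0 (((Mu O.merged : ℕ) : ℤ) + 2) (KS.r₀A Φ t O.merged 0 (O.merged.R (O.merged.scale t (KS.MBF κ Φ t p O.merged cF 0) (KS.nBF κ Φ t p O.merged cF 0))))).ℓs (KS.apron Φ t O.merged 0 (((Mu O.merged : ℕ) : ℤ) + 2) (KS.r₀A Φ t O.merged 0 (O.merged.R (O.merged.scale t (KS.MBF κ Φ t p O.merged cF 0) (KS.nBF κ Φ t p O.merged cF 0))))).M + 1) + (KS.apron Φ t O.merged 0 (((Mu O.merged : ℕ) : ℤ) + 2) (KS.r₀A Φ t O.merged 0 (O.merged.R (O.merged.scale t (KS.MBF κ Φ t p O.merged cF 0) (KS.nBF κ Φ t p O.merged cF 0))))).N * (KS.apron Φ t O.merged 0 (((Mu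 O.merged : ℕ) : ℤ) + 2) (KS.r₀A Φ t O.merged 0 (O.merged.R (O.merged.scale t (KS.MBF κ Φ t p O.merged cF 0) (KS.nBF κ Φ t p O.merged cF 0))))).d + (KS.KCmax t O.merged 0)) ≤ (B σ').R')
    (Qb Fb : ℤ → V → Finset V)
    (hQb : ∀ σ' : ℤ, σ' = 1 ∨ σ' = -1 → ∀ c c', ∀ w ∈ Qb σ' c', w ∈ graphBall G c' (O.merged.R (O.merged.scale t (KS.MBF κ Φ t p O.merged cF 0) (KS.nBF κ Φ t p O.merged cF 0))) ∧
      rootFrame (φL κ Φ t p O.D O.DT O.ori (gOf κ Φ t p O (KS.gT 0 gx)) (fOf κ Φ t p O (KS.fT 0 fx))) c σ' w ∈ Finset.Icc (rootFrame (φL κ Φ t p O.D O.DT O.ori (gOf κ Φ t p O (KS.gT 0 gx)) (fOf κ Φ t p O (KS.fT 0 fx))) c σ' c' - (((B σ').pr : ℕ) : Site 2)) (rootFrame (φL κ Φ t p O.D O.DT O.ori (gOf κ Φ t p O (KS.gT 0 gx)) (fOf κ Φ t p O (KS.fT 0 fx))) c σ' c' + (((B σ').pr : ℕ) : Site 2)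))
    (hFb : ∀ σ' : ℤ, σ' = 1 ∨ σ' = -1 → ∀ c c', ∀ w ∈ Fb σ' c', w ∈ Qb σ' c' ∧
      rootFrame (φL κ Φ t p O.D O.DT O.ori (gOf κ Φ t p O (KS.gT 0 gx)) (fOf κ Φ t p O (KS.fT 0 fx))) c σ' w ∈ Finset.Icc (rootFrame (φL κ Φ t p O.D O.DT O.ori (gOf κ Φ t p O (KS.gT 0 gx)) (fOf κ Φ t p O (KS.fT 0 fx))) c σ' c' + (B σ').dlo) (rootFrame (φL κ Φ t p O.D O.DT O.ori (gOf κ Φ t p O (KS.gT 0 gx)) (fOf κ Φ t p O (KS.fT 0 fx))) c σ' c' + (B σ').dhi))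
    (hFZ : ∀ σ' : ℤ, σ' = 1 ∨ σ' = -1 → ∀ c', Disjoint (Fb σ' c') (O.merged.Λ c' (Mu O.merged)))
    (hbridge : ∀ σ' : ℤ, σ' = 1 ∨ σ' = -1 → ∀ c', 1 - (Neg.δkit κ Φ) ^ 2 < (bondPercolation G q).real (linkIn (↑(Qb σ' c') : Set V) (O.merged.Λ c' O.merged.k) (Fb σ' c')))
    (numsX : ∀ (a' : ℕ) (x : Site 2) (du : MDir) (j : ℕ) (pc : ℤ) (c' : V), du.1 = 0 → j < (fcellsA κ Φ t p O.merged (gOf κ Φ t p O (KS.gT 0 gx)) (fOf κ Φ t p O (KS.fT 0 fx))).K → ∀ yF : V,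
      (prFA κ Φ t p O.merged (gOf κ Φ t p O (KS.gT 0 gx)) (fOf κ Φ t p O (KS.fT 0 fx))).ψ (φL κ Φ t p O.D O.DT O.ori (gOf κ Φ t p O (KS.gT 0 gx)) (fOf κ Φ t p O (KS.fT 0 fx))) t yF = (fcellsA κ Φ t p O.merged (gOf κ Φ t p O (KS.gT 0 gx)) (fOf κ Φ t p O (KS.fT 0 fx))).faceCen x du j → pc = relφ (φL κ Φ t p O.D O.DT O.ori (gOf κ Φ t p O (KS.gT 0 gx)) (fOf κ Φ t p O (KS.fT 0 fx))) t yF ((prFA κ Φ t p O.merged (gOf κ Φ t p O (KS.gT 0 gx)) (fOf κ Φ t p O (KS.fT 0 fx))).bOf du.1) →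
      (prFA κ Φ t p O.merged (gOf κ Φ t p O (KS.gT 0 gx)) (fOf κ Φ t p O (KS.fT 0 fx))).frame (φL κ Φ t p O.D O.DT O.ori (gOf κ Φ t p O (KS.gT 0 gx)) (fOf κ Φ t p O (KS.fT 0 fx))) t du.1 ((prFA κ Φ t p O.merged (gOf κ Φ t p O (KS.gT 0 gx)) (fOf κ Φ t p O (KS.fT 0 fx))).bOf du.1) c' ∈ Finset.Icc (loN (fcellsA κ Φ t p O.merged (gOf κ Φ t p O (KS.gT 0 gx)) (fOf κ Φ t p O (KS.fT 0 fx))) x du j pc ((fun du : MDir => ((prFA κ Φ t p O.merged (gOf κ Φ t p O (KS.gT 0 gx)) (fOf κ Φ t p O (KS.fT 0 fx))).awF₂ (fcellsA κ Φ t p O.merged (gOf κ Φ t p O (KS.gT 0 gx)) (fOf κ Φ t p O (KS.fT 0 fx))) du).toNat) du) - (((KS.RlevA κ Φ t p O.merged 0 + KS.reachA t O.merged 0) : ℕ) : Site 2)) (hiN (fcellsA κ Φ t p O.merged (gOf κ Φ t p O (KS.gT 0 gx)) (fOf κ Φ t p O (KS.fT 0 fx))) x du j pc ((fun du : MDir =>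 ((prFA κ Φ t p O.merged (gOf κ Φ t p O (KS.gT 0 gx)) (fOf κ Φ t p O (KS.fT 0 fx))).awF₂ (fcellsA κ Φ t p O.merged (gOf κ Φ t p O (KS.gT 0 gx)) (fOf κ Φ t p O (KS.fT 0 fx))) du).toNat) du) + (((KS.RlevA κ Φ t p O.merged 0 + KS.reachA t O.merged 0) : ℕ) : Site 2)) →
      c' ∈ graphBall G t ((concRadii2N (fcellsA κ Φ t p O.merged (gOf κ Φ t p O (KS.gT 0 gx)) (fOf κ Φ t p O (KS.fT 0 fx))) (Skelφ.Prm.gap ((SUA ex mx) κ Φ t p O.merged (gOf κ Φ t p O (KS.gT 0 gx)) (fOf κ Φ t p O (KS.fT 0 fx)) q)) (fun _ : ℕ => (0:ℕ)) (Skelφ.Prm.E₀ ((SUA ex mx) κ Φ t p O.merged (gOf κ Φ t p O (KS.gT 0 gx)) (fOf κ Φ t p O (KS.fT 0 fx)) q)) (Skelφ.Prm.Lp ((SUA ex mx) κ Φ t p O.merged (gOf κ Φ t p O (KS.gT 0 gx)) (fOf κ Φ t p O (KS.fT 0 fx)) q)) (offNA κ Φ t p O.merged (gOf κ Φ t p O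 (KS.gT 0 gx)) (fOf κ Φ t p O (KS.fT 0 fx)))).rE a' x du - (Skelφ.Prm.Lp (SUA ex mx κ Φ t p O.merged (gOf κ Φ t p O (KS.gT 0 gx)) (fOf κ Φ t p O (KS.fT 0 fx)) q))) →
      (Skelφ.Prm.Lp ((SUA ex mx) κ Φ t p O.merged (gOf κ Φ t p O (KS.gT 0 gx)) (fOf κ Φ t p O (KS.fT 0 fx)) q)) ≤ (concRadii2N (fcellsA κ Φ t p O.merged (gOf κ Φ t p O (KS.gT 0 gx)) (fOf κ Φ t p O (KS.fT 0 fx))) (Skelφ.Prm.gap ((SUA ex mx) κ Φ t p O.merged (gOf κ Φ t p O (KS.gT 0 gx)) (fOf κ Φ t p O (KS.fT 0 fx)) q)) (fun _ : ℕ => (0:ℕ)) (Skelφ.Prm.E₀ ((SUA ex mx) κ Φ t p O.merged (gOf κ Φ t p O (KS.gT 0 gx)) (fOf κ Φ t p O (KS.fT 0 fx)) q)) (Skelφ.Prm.Lp ((SUA ex mx) κ Φ t p O.merged (gOf κ Φ t p O (KS.gT 0 gx)) (fOf κ Φ t p O (KS.fT 0 fx)) q)) (offNA κ Φ t p O.merged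 (gOf κ Φ t p O (KS.gT 0 gx)) (fOf κ Φ t p O (KS.fT 0 fx)))).rM a' (x + stepVec du) → (Skelφ.Prm.Lp (SUA ex mx κ Φ t p O.merged (gOf κ Φ t p O (KS.gT 0 gx)) (fOf κ Φ t p O (KS.fT 0 fx)) q)) ≤ (concRadii2N (fcellsA κ Φ t p O.merged (gOf κ Φ t p O (KS.gT 0 gx)) (fOf κ Φ t p O (KS.fT 0 fx))) (Skelφ.Prm.gap ((SUA ex mx) κ Φ t p O.merged (gOf κ Φ t p O (KS.gT 0 gx)) (fOf κ Φ t p O (KS.fT 0 fx)) q)) (fun _ : ℕ => (0:ℕ)) (Skelφ.Prm.E₀ ((SUA ex mx) κ Φ t p O.merged (gOf κ Φ t p O (KS.gT 0 gx)) (fOf κ Φ t p O (KS.fT 0 fx)) q)) (Skelφ.Prm.Lp ((SUA ex mx) κ Φ t p O.merged (gOf κ Φ t p O (KS.gT 0 gx)) (fOf κ Φ t p O (KS.fT 0 fx)) q)) (offNA κ Φ t p O.merged (gOf κ Φ t p O (KS.gT 0 gx)) (fOf κ Φ t p O (KS.fT 0 fx)))).rE a' x du →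
      FaceRunNumsX4 G (φL κ Φ t p O.D O.DT O.ori (gOf κ Φ t p O (KS.gT 0 gx)) (fOf κ Φ t p O (KS.fT 0 fx))) ((prFA κ Φ t p O.merged (gOf κ Φ t p O (KS.gT 0 gx)) (fOf κ Φ t p O (KS.fT 0 fx))).ψ (φL κ Φ t p O.D O.DT O.ori (gOf κ Φ t p O (KS.gT 0 gx)) (fOf κ Φ t p O (KS.fT 0 fx))) t) c' (prFA κ Φ t p O.merged (gOf κ Φ t p O (KS.gT 0 gx)) (fOf κ Φ t p O (KS.fT 0 fx))).A (nL κ Φ t p O.merged (gOf κ Φ t p O (KS.gT 0 gx)) (fOf κ Φ t p O (KS.fT 0 fx))) (prFA κ Φ t p O.merged (gOf κ Φ t p O (KS.gT 0 gx)) (fOf κ Φ t p O (KS.fT 0 fx))).h (prFA κ Φ t p O.merged (gOf κ Φ t p O (KS.gT 0 gx)) (fOf κ Φ t p O (KS.fT 0 fx))).vα (prFA κ Φ t p O.merged (gOf κ Φ t p O (KS.gT 0 gx)) (fOf κ Φ t p O (KS.fT 0 fx))).vβ (prFA κ Φ t p O.merged (gOf κ Φ t p O (KS.gT 0 gx)) (fOf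 κ Φ t p O (KS.fT 0 fx))).c₀ (prFA κ Φ t p O.merged (gOf κ Φ t p O (KS.gT 0 gx)) (fOf κ Φ t p O (KS.fT 0 fx))).c₁ (prFA κ Φ t p O.merged (gOf κ Φ t p O (KS.gT 0 gx)) (fOf κ Φ t p O (KS.fT 0 fx))).D du (sgOf du) (B (sgOf du)) (ℓL κ Φ t p O.merged (gOf κ Φ t p O (KS.gT 0 gx)) (fOf κ Φ t p O (KS.fT 0 fx))) (KS.RA' κ Φ t p O.merged 0) qB (KS.RA' κ Φ t p O.merged 0) qB₃ (prFA κ Φ t p O.merged (gOf κ Φ t p O (KS.gT 0 gx)) (fOf κ Φ t p O (KS.fT 0 fx))).vα hnL hvL hlay (Mu O.merged)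
        ((fcellsA κ Φ t p O.merged (gOf κ Φ t p O (KS.gT 0 gx)) (fOf κ Φ t p O (KS.fT 0 fx))).farCore x du j (3 : ℤ)) (targetMM G (φL κ Φ t p O.D O.DT O.ori (gOf κ Φ t p O (KS.gT 0 gx)) (fOf κ Φ t p O (KS.fT 0 fx))) (prFA κ Φ t p O.merged (gOf κ Φ t p O (KS.gT 0 gx)) (fOf κ Φ t p O (KS.fT 0 fx))) (fcellsA κ Φ t p O.merged (gOf κ Φ t p O (KS.gT 0 gx)) (fOf κ Φ t p O (KS.fT 0 fx))) t (concRadii2N (fcellsA κ Φ t p O.merged (gOf κ Φ t p O (KS.gT 0 gx)) (fOf κ Φ t p O (KS.fT 0 fx))) (Skelφ.Prm.gap ((SUA ex mx) κ Φ t p O.merged (gOf κ Φ t p O (KS.gT 0 gx)) (fOf κ Φ t p O (KS.fT 0 fx)) q)) (fun _ : ℕ => (0:ℕ)) (Skelφ.Prm.E₀ ((SUA ex mx) κ Φ t p O.merged (gOf κ Φ t p O (KS.gT 0 gx)) (fOf κ Φ t p O (KS.fT 0 fx)) q)) (Skelφ.Prm.Lp ((SUA ex mx) κ Φ t p O.merged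 (gOf κ Φ t p O (KS.gT 0 gx)) (fOf κ Φ t p O (KS.fT 0 fx)) q)) (offNA κ Φ t p O.merged (gOf κ Φ t p O (KS.gT 0 gx)) (fOf κ Φ t p O (KS.fT 0 fx)))) (b0TA κ Φ t p O.merged (gOf κ Φ t p O (KS.gT 0 gx)) (fOf κ Φ t p O (KS.fT 0 fx))) a' x du (Skelφ.Prm.Lp ((SUA ex mx) κ Φ t p O.merged (gOf κ Φ t p O (KS.gT 0 gx)) (fOf κ Φ t p O (KS.fT 0 fx)) q))) (O.merged.Λ c' (Mu O.merged)) (Skelφ.Prm.Lp (SUA ex mx κ Φ t p O.merged (gOf κ Φ t p O (KS.gT 0 gx)) (fOf κ Φ t p O (KS.fT 0 fx)) q)) (kA du.1) (kA (oth du.1)))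
    (numsY : ∀ (a' : ℕ) (x : Site 2) (du : MDir) (j : ℕ) (pc : ℤ) (c' : V), du.1 = 1 → j < (fcellsA κ Φ t p O.merged (gOf κ Φ t p O (KS.gT 0 gx)) (fOf κ Φ t p O (KS.fT 0 fx))).K → ∀ yF : V,
      (prFA κ Φ t p O.merged (gOf κ Φ t p O (KS.gT 0 gx)) (fOf κ Φ t p O (KS.fT 0 fx))).ψ (φL κ Φ t p O.D O.DT O.ori (gOf κ Φ t p O (KS.gT 0 gx)) (fOf κ Φ t p O (KS.fT 0 fx))) t yF = (fcellsA κ Φ t p O.merged (gOf κ Φ t p O (KS.gT 0 gx)) (fOf κ Φ t p O (KS.fT 0 fx))).faceCen x du j → pc = relφ (φL κ Φ t p O.D O.DT O.ori (gOf κ Φ t p O (KS.gT 0 gx)) (fOf κ Φ t p O (KS.fT 0 fx))) t yF ((prFA κ Φ t p O.merged (gOf κ Φ t p O (KS.gT 0 gx)) (fOf κ Φ t p O (KS.fT 0 fx))).bOf du.1) →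
      (prFA κ Φ t p O.merged (gOf κ Φ t p O (KS.gT 0 gx)) (fOf κ Φ t p O (KS.fT 0 fx))).frame (φL κ Φ t p O.D O.DT O.ori (gOf κ Φ t p O (KS.gT 0 gx)) (fOf κ Φ t p O (KS.fT 0 fx))) t du.1 ((prFA κ Φ t p O.merged (gOf κ Φ t p O (KS.gT 0 gx)) (fOf κ Φ t p O (KS.fT 0 fx))).bOf du.1) c' ∈ Finset.Icc (loN (fcellsA κ Φ t p O.merged (gOf κ Φ t p O (KS.gT 0 gx)) (fOf κ Φ t p O (KS.fT 0 fx))) x du j pc ((fun du : MDir => ((prFA κ Φ t p O.merged (gOf κ Φ t p O (KS.gT 0 gx)) (fOf κ Φ t p O (KS.fT 0 fx))).awF₂ (fcellsA κ Φ t p O.merged (gOf κ Φ t p O (KS.gT 0 gx)) (fOf κ Φ t p O (KS.fT 0 fx))) du).toNat) du) - (((KS.RlevA κ Φ t p O.merged 0 + KS.reachA t O.merged 0) : ℕ) : Site 2)) (hiN (fcellsA κ Φ t p O.merged (gOf κ Φ t p O (KS.gT 0 gx)) (fOf κ Φ t p O (KS.fT 0 fx))) x du j pc ((fun du : MDir =>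 ((prFA κ Φ t p O.merged (gOf κ Φ t p O (KS.gT 0 gx)) (fOf κ Φ t p O (KS.fT 0 fx))).awF₂ (fcellsA κ Φ t p O.merged (gOf κ Φ t p O (KS.gT 0 gx)) (fOf κ Φ t p O (KS.fT 0 fx))) du).toNat) du) + (((KS.RlevA κ Φ t p O.merged 0 + KS.reachA t O.merged 0) : ℕ) : Site 2)) →
      c' ∈ graphBall G t ((concRadii2N (fcellsA κ Φ t p O.merged (gOf κ Φ t p O (KS.gT 0 gx)) (fOf κ Φ t p O (KS.fT 0 fx))) (Skelφ.Prm.gap ((SUA ex mx) κ Φ t p O.merged (gOf κ Φ t p O (KS.gT 0 gx)) (fOf κ Φ t p O (KS.fT 0 fx)) q)) (fun _ : ℕ => (0:ℕ)) (Skelφ.Prm.E₀ ((SUA ex mx) κ Φ t p O.merged (gOf κ Φ t p O (KS.gT 0 gx)) (fOf κ Φ t p O (KS.fT 0 fx)) q)) (Skelφ.Prm.Lp ((SUA ex mx) κ Φ t p O.merged (gOf κ Φ t p O (KS.gT 0 gx)) (fOf κ Φ t p O (KS.fT 0 fx)) q)) (offNA κ Φ t p O.merged (gOf κ Φ t p O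 (KS.gT 0 gx)) (fOf κ Φ t p O (KS.fT 0 fx)))).rE a' x du - (Skelφ.Prm.Lp (SUA ex mx κ Φ t p O.merged (gOf κ Φ t p O (KS.gT 0 gx)) (fOf κ Φ t p O (KS.fT 0 fx)) q))) →
      (Skelφ.Prm.Lp ((SUA ex mx) κ Φ t p O.merged (gOf κ Φ t p O (KS.gT 0 gx)) (fOf κ Φ t p O (KS.fT 0 fx)) q)) ≤ (concRadii2N (fcellsA κ Φ t p O.merged (gOf κ Φ t p O (KS.gT 0 gx)) (fOf κ Φ t p O (KS.fT 0 fx))) (Skelφ.Prm.gap ((SUA ex mx) κ Φ t p O.merged (gOf κ Φ t p O (KS.gT 0 gx)) (fOf κ Φ t p O (KS.fT 0 fx)) q)) (fun _ : ℕ => (0:ℕ)) (Skelφ.Prm.E₀ ((SUA ex mx) κ Φ t p O.merged (gOf κ Φ t p O (KS.gT 0 gx)) (fOf κ Φ t p O (KS.fT 0 fx)) q)) (Skelφ.Prm.Lp ((SUA ex mx) κ Φ t p O.merged (gOf κ Φ t p O (KS.gT 0 gx)) (fOf κ Φ t p O (KS.fT 0 fx)) q)) (offNA κ Φ t p O.merged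 (gOf κ Φ t p O (KS.gT 0 gx)) (fOf κ Φ t p O (KS.fT 0 fx)))).rM a' (x + stepVec du) → (Skelφ.Prm.Lp (SUA ex mx κ Φ t p O.merged (gOf κ Φ t p O (KS.gT 0 gx)) (fOf κ Φ t p O (KS.fT 0 fx)) q)) ≤ (concRadii2N (fcellsA κ Φ t p O.merged (gOf κ Φ t p O (KS.gT 0 gx)) (fOf κ Φ t p O (KS.fT 0 fx))) (Skelφ.Prm.gap ((SUA ex mx) κ Φ t p O.merged (gOf κ Φ t p O (KS.gT 0 gx)) (fOf κ Φ t p O (KS.fT 0 fx)) q)) (fun _ : ℕ => (0:ℕ)) (Skelφ.Prm.E₀ ((SUA ex mx) κ Φ t p O.merged (gOf κ Φ t p O (KS.gT 0 gx)) (fOf κ Φ t p O (KS.fT 0 fx)) q)) (Skelφ.Prm.Lp ((SUA ex mx) κ Φ t p O.merged (gOf κ Φ t p O (KS.gT 0 gx)) (fOf κ Φ t p O (KS.fT 0 fx)) q)) (offNA κ Φ t p O.merged (gOf κ Φ t p O (KS.gT 0 gx)) (fOf κ Φ t p O (KS.fT 0 fx)))).rE a' x du →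
      FaceRunNumsY4 G (φL κ Φ t p O.D O.DT O.ori (gOf κ Φ t p O (KS.gT 0 gx)) (fOf κ Φ t p O (KS.fT 0 fx))) ((prFA κ Φ t p O.merged (gOf κ Φ t p O (KS.gT 0 gx)) (fOf κ Φ t p O (KS.fT 0 fx))).ψ (φL κ Φ t p O.D O.DT O.ori (gOf κ Φ t p O (KS.gT 0 gx)) (fOf κ Φ t p O (KS.fT 0 fx))) t) c' (prFA κ Φ t p O.merged (gOf κ Φ t p O (KS.gT 0 gx)) (fOf κ Φ t p O (KS.fT 0 fx))).A (nL κ Φ t p O.merged (gOf κ Φ t p O (KS.gT 0 gx)) (fOf κ Φ t p O (KS.fT 0 fx))) (prFA κ Φ t p O.merged (gOf κ Φ t p O (KS.gT 0 gx)) (fOf κ Φ t p O (KS.fT 0 fx))).h (prFA κ Φ t p O.merged (gOf κ Φ t p O (KS.gT 0 gx)) (fOf κ Φ t p O (KS.fT 0 fx))).vα (prFA κ Φ t p O.merged (gOf κ Φ t p O (KS.gT 0 gx)) (fOf κ Φ t p O (KS.fT 0 fx))).vβ (prFA κ Φ t p O.merged (gOf κ Φ t p O (KS.gT 0 gx)) (fOf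 κ Φ t p O (KS.fT 0 fx))).c₀ (prFA κ Φ t p O.merged (gOf κ Φ t p O (KS.gT 0 gx)) (fOf κ Φ t p O (KS.fT 0 fx))).c₁ (prFA κ Φ t p O.merged (gOf κ Φ t p O (KS.gT 0 gx)) (fOf κ Φ t p O (KS.fT 0 fx))).D du (σhF du) (sgOf du) (B (σhF du)) (ℓL κ Φ t p O.merged (gOf κ Φ t p O (KS.gT 0 gx)) (fOf κ Φ t p O (KS.fT 0 fx))) (KS.RA' κ Φ t p O.merged 0) qB' (KS.RA' κ Φ t p O.merged 0) qB₃' (prFA κ Φ t p O.merged (gOf κ Φ t p O (KS.gT 0 gx)) (fOf κ Φ t p O (KS.fT 0 fx))).vα hnL hvL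
        hlay (Mu O.merged) ((fcellsA κ Φ t p O.merged (gOf κ Φ t p O (KS.gT 0 gx)) (fOf κ Φ t p O (KS.fT 0 fx))).farCore x du j (3 : ℤ)) (targetMM G (φL κ Φ t p O.D O.DT O.ori (gOf κ Φ t p O (KS.gT 0 gx)) (fOf κ Φ t p O (KS.fT 0 fx))) (prFA κ Φ t p O.merged (gOf κ Φ t p O (KS.gT 0 gx)) (fOf κ Φ t p O (KS.fT 0 fx))) (fcellsA κ Φ t p O.merged (gOf κ Φ t p O (KS.gT 0 gx)) (fOf κ Φ t p O (KS.fT 0 fx))) t (concRadii2N (fcellsA κ Φ t p O.merged (gOf κ Φ t p O (KS.gT 0 gx)) (fOf κ Φ t p O (KS.fT 0 fx))) (Skelφ.Prm.gap ((SUA ex mx) κ Φ t p O.merged (gOf κ Φ t p O (KS.gT 0 gx)) (fOf κ Φ t p O (KS.fT 0 fx)) q)) (fun _ : ℕ => (0:ℕ)) (Skelφ.Prm.E₀ ((SUA ex mx) κ Φ t p O.merged (gOf κ Φ t p O (KS.gT 0 gx)) (fOf κ Φ t p O (KS.fT 0 fx)) q)) (Skelφ.Prm.Lp ((SUA ex mx)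 κ Φ t p O.merged (gOf κ Φ t p O (KS.gT 0 gx)) (fOf κ Φ t p O (KS.fT 0 fx)) q)) (offNA κ Φ t p O.merged (gOf κ Φ t p O (KS.gT 0 gx)) (fOf κ Φ t p O (KS.fT 0 fx)))) (b0TA κ Φ t p O.merged (gOf κ Φ t p O (KS.gT 0 gx)) (fOf κ Φ t p O (KS.fT 0 fx))) a' x du (Skelφ.Prm.Lp ((SUA ex mx) κ Φ t p O.merged (gOf κ Φ t p O (KS.gT 0 gx)) (fOf κ Φ t p O (KS.fT 0 fx)) q))) (O.merged.Λ c' (Mu O.merged)) (Skelφ.Prm.Lp (SUA ex mx κ Φ t p O.merged (gOf κ Φ t p O (KS.gT 0 gx)) (fOf κ Φ t p O (KS.fT 0 fx)) q)) (kA du.1) (kA (oth du.1)))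
    (hnFx : ∀ (a' : ℕ) (x : Site 2) (du : MDir) (j : ℕ) (pc : ℤ) (c' : V) (hI : du.1 = 0) (hj : j < (fcellsA κ Φ t p O.merged (gOf κ Φ t p O (KS.gT 0 gx)) (fOf κ Φ t p O (KS.fT 0 fx))).K) (yF : V)
      (hyF : (prFA κ Φ t p O.merged (gOf κ Φ t p O (KS.gT 0 gx)) (fOf κ Φ t p O (KS.fT 0 fx))).ψ (φL κ Φ t p O.D O.DT O.ori (gOf κ Φ t p O (KS.gT 0 gx)) (fOf κ Φ t p O (KS.fT 0 fx))) t yF = (fcellsA κ Φ t p O.merged (gOf κ Φ t p O (KS.gT 0 gx)) (fOf κ Φ t p O (KS.fT 0 fx))).faceCen x du j) (hpc : pc = relφ (φL κ Φ t p O.D O.DT O.ori (gOf κ Φ t p O (KS.gT 0 gx)) (fOf κ Φ t p O (KS.fT 0 fx))) t yF ((prFA κ Φ t p O.merged (gOf κ Φ t p O (KS.gT 0 gx)) (fOf κ Φ t p O (KS.fT 0 fx))).bOf du.1))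
      (h1 : (prFA κ Φ t p O.merged (gOf κ Φ t p O (KS.gT 0 gx)) (fOf κ Φ t p O (KS.fT 0 fx))).frame (φL κ Φ t p O.D O.DT O.ori (gOf κ Φ t p O (KS.gT 0 gx)) (fOf κ Φ t p O (KS.fT 0 fx))) t du.1 ((prFA κ Φ t p O.merged (gOf κ Φ t p O (KS.gT 0 gx)) (fOf κ Φ t p O (KS.fT 0 fx))).bOf du.1) c' ∈ Finset.Icc (loN (fcellsA κ Φ t p O.merged (gOf κ Φ t p O (KS.gT 0 gx)) (fOf κ Φ t p O (KS.fT 0 fx))) x du j pc ((fun du : MDir => ((prFA κ Φ t p O.merged (gOf κ Φ t p O (KS.gT 0 gx)) (fOf κ Φ t p O (KS.fT 0 fx))).awF₂ (fcellsA κ Φ t p O.merged (gOf κ Φ t p O (KS.gT 0 gx)) (fOf κ Φ t p O (KS.fT 0 fx))) du).toNat) du) - (((KS.RlevA κ Φ t p O.merged 0 + KS.reachA t O.merged 0) : ℕ) : Site 2)) (hiN (fcellsA κ Φ t p O.merged (gOf κ Φ t p O (KS.gT 0 gx)) (fOf κ Φ t p O (KS.fT 0 fx))) x du j pc ((fun du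 : MDir => ((prFA κ Φ t p O.merged (gOf κ Φ t p O (KS.gT 0 gx)) (fOf κ Φ t p O (KS.fT 0 fx))).awF₂ (fcellsA κ Φ t p O.merged (gOf κ Φ t p O (KS.gT 0 gx)) (fOf κ Φ t p O (KS.fT 0 fx))) du).toNat) du) + (((KS.RlevA κ Φ t p O.merged 0 + KS.reachA t O.merged 0) : ℕ) : Site 2)))
      (h2 : c' ∈ graphBall G t ((concRadii2N (fcellsA κ Φ t p O.merged (gOf κ Φ t p O (KS.gT 0 gx)) (fOf κ Φ t p O (KS.fT 0 fx))) (Skelφ.Prm.gap ((SUA ex mx) κ Φ t p O.merged (gOf κ Φ t p O (KS.gT 0 gx)) (fOf κ Φ t p O (KS.fT 0 fx)) q)) (fun _ : ℕ => (0:ℕ)) (Skelφ.Prm.E₀ ((SUA ex mx) κ Φ t p O.merged (gOf κ Φ t p O (KS.gT 0 gx)) (fOf κ Φ t p O (KS.fT 0 fx)) q)) (Skelφ.Prm.Lp ((SUA ex mx) κ Φ t p O.merged (gOf κ Φ t p O (KS.gT 0 gx)) (fOf κ Φ t p O (KS.fT 0 fx)) q)) (offNA κ Φ t p O.merged (gOf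 κ Φ t p O (KS.gT 0 gx)) (fOf κ Φ t p O (KS.fT 0 fx)))).rE a' x du - (Skelφ.Prm.Lp (SUA ex mx κ Φ t p O.merged (gOf κ Φ t p O (KS.gT 0 gx)) (fOf κ Φ t p O (KS.fT 0 fx)) q))))
      (hM : (Skelφ.Prm.Lp ((SUA ex mx) κ Φ t p O.merged (gOf κ Φ t p O (KS.gT 0 gx)) (fOf κ Φ t p O (KS.fT 0 fx)) q)) ≤ (concRadii2N (fcellsA κ Φ t p O.merged (gOf κ Φ t p O (KS.gT 0 gx)) (fOf κ Φ t p O (KS.fT 0 fx))) (Skelφ.Prm.gap ((SUA ex mx) κ Φ t p O.merged (gOf κ Φ t p O (KS.gT 0 gx)) (fOf κ Φ t p O (KS.fT 0 fx)) q)) (fun _ : ℕ => (0:ℕ)) (Skelφ.Prm.E₀ ((SUA ex mx) κ Φ t p O.merged (gOf κ Φ t p O (KS.gT 0 gx)) (fOf κ Φ t p O (KS.fT 0 fx)) q)) (Skelφ.Prm.Lp ((SUA ex mx) κ Φ t p O.merged (gOf κ Φ t p O (KS.gT 0 gx)) (fOf κ Φ t p O (KS.fT 0 fx)) q)) (offNA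 κ Φ t p O.merged (gOf κ Φ t p O (KS.gT 0 gx)) (fOf κ Φ t p O (KS.fT 0 fx)))).rM a' (x + stepVec du)) (hE : (Skelφ.Prm.Lp (SUA ex mx κ Φ t p O.merged (gOf κ Φ t p O (KS.gT 0 gx)) (fOf κ Φ t p O (KS.fT 0 fx)) q)) ≤ (concRadii2N (fcellsA κ Φ t p O.merged (gOf κ Φ t p O (KS.gT 0 gx)) (fOf κ Φ t p O (KS.fT 0 fx))) (Skelφ.Prm.gap ((SUA ex mx) κ Φ t p O.merged (gOf κ Φ t p O (KS.gT 0 gx)) (fOf κ Φ t p O (KS.fT 0 fx)) q)) (fun _ : ℕ => (0:ℕ)) (Skelφ.Prm.E₀ ((SUA ex mx) κ Φ t p O.merged (gOf κ Φ t p O (KS.gT 0 gx)) (fOf κ Φ t p O (KS.fT 0 fx)) q)) (Skelφ.Prm.Lp ((SUA ex mx) κ Φ t p O.merged (gOf κ Φ t p O (KS.gT 0 gx)) (fOf κ Φ t p O (KS.fT 0 fx)) q)) (offNA κ Φ t p O.merged (gOf κ Φ t p O (KS.gT 0 gx)) (fOf κ Φ t p O (KS.fT 0 fx)))).rE a' x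 du),
      0 + 1 + (numsX a' x du j pc c' hI hj yF hyF hpc h1 h2 hM hE).Nr + 1 + (numsX a' x du j pc c' hI hj yF hyF hpc h1 h2 hM hE).N₃ ≤ (NegB.nFA κ.K₀))
    (hnFy : ∀ (a' : ℕ) (x : Site 2) (du : MDir) (j : ℕ) (pc : ℤ) (c' : V) (hI : du.1 = 1) (hj : j < (fcellsA κ Φ t p O.merged (gOf κ Φ t p O (KS.gT 0 gx)) (fOf κ Φ t p O (KS.fT 0 fx))).K) (yF : V)
      (hyF : (prFA κ Φ t p O.merged (gOf κ Φ t p O (KS.gT 0 gx)) (fOf κ Φ t p O (KS.fT 0 fx))).ψ (φL κ Φ t p O.D O.DT O.ori (gOf κ Φ t p O (KS.gT 0 gx)) (fOf κ Φ t p O (KS.fT 0 fx))) t yF = (fcellsA κ Φ t p O.merged (gOf κ Φ t p O (KS.gT 0 gx)) (fOf κ Φ t p O (KS.fT 0 fx))).faceCen x du j) (hpc : pc = relφ (φL κ Φ t p O.D O.DT O.ori (gOf κ Φ t p O (KS.gT 0 gx)) (fOf κ Φ t p O (KS.fT 0 fx))) t yF ((prFA κ Φ t p O.merged (gOf κ Φ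 t p O (KS.gT 0 gx)) (fOf κ Φ t p O (KS.fT 0 fx))).bOf du.1))
      (h1 : (prFA κ Φ t p O.merged (gOf κ Φ t p O (KS.gT 0 gx)) (fOf κ Φ t p O (KS.fT 0 fx))).frame (φL κ Φ t p O.D O.DT O.ori (gOf κ Φ t p O (KS.gT 0 gx)) (fOf κ Φ t p O (KS.fT 0 fx))) t du.1 ((prFA κ Φ t p O.merged (gOf κ Φ t p O (KS.gT 0 gx)) (fOf κ Φ t p O (KS.fT 0 fx))).bOf du.1) c' ∈ Finset.Icc (loN (fcellsA κ Φ t p O.merged (gOf κ Φ t p O (KS.gT 0 gx)) (fOf κ Φ t p O (KS.fT 0 fx))) x du j pc ((fun du : MDir => ((prFA κ Φ t p O.merged (gOf κ Φ t p O (KS.gT 0 gx)) (fOf κ Φ t p O (KS.fT 0 fx))).awF₂ (fcellsA κ Φ t p O.merged (gOf κ Φ t p O (KS.gT 0 gx)) (fOf κ Φ t p O (KS.fT 0 fx))) du).toNat) du) - (((KS.RlevA κ Φ t p O.merged 0 + KS.reachA t O.merged 0) : ℕ) : Site 2)) (hiN (fcellsA κ Φ t p O.merged (gOf κ Φ t p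 O (KS.gT 0 gx)) (fOf κ Φ t p O (KS.fT 0 fx))) x du j pc ((fun du : MDir => ((prFA κ Φ t p O.merged (gOf κ Φ t p O (KS.gT 0 gx)) (fOf κ Φ t p O (KS.fT 0 fx))).awF₂ (fcellsA κ Φ t p O.merged (gOf κ Φ t p O (KS.gT 0 gx)) (fOf κ Φ t p O (KS.fT 0 fx))) du).toNat) du) + (((KS.RlevA κ Φ t p O.merged 0 + KS.reachA t O.merged 0) : ℕ) : Site 2)))
      (h2 : c' ∈ graphBall G t ((concRadii2N (fcellsA κ Φ t p O.merged (gOf κ Φ t p O (KS.gT 0 gx)) (fOf κ Φ t p O (KS.fT 0 fx))) (Skelφ.Prm.gap ((SUA ex mx) κ Φ t p O.merged (gOf κ Φ t p O (KS.gT 0 gx)) (fOf κ Φ t p O (KS.fT 0 fx)) q)) (fun _ : ℕ => (0:ℕ)) (Skelφ.Prm.E₀ ((SUA ex mx) κ Φ t p O.merged (gOf κ Φ t p O (KS.gT 0 gx)) (fOf κ Φ t p O (KS.fT 0 fx)) q)) (Skelφ.Prm.Lp ((SUA ex mx) κ Φ t p O.merged (gOf κ Φ t p O (KS.gT 0 gx))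 (fOf κ Φ t p O (KS.fT 0 fx)) q)) (offNA κ Φ t p O.merged (gOf κ Φ t p O (KS.gT 0 gx)) (fOf κ Φ t p O (KS.fT 0 fx)))).rE a' x du - (Skelφ.Prm.Lp (SUA ex mx κ Φ t p O.merged (gOf κ Φ t p O (KS.gT 0 gx)) (fOf κ Φ t p O (KS.fT 0 fx)) q))))
      (hM : (Skelφ.Prm.Lp ((SUA ex mx) κ Φ t p O.merged (gOf κ Φ t p O (KS.gT 0 gx)) (fOf κ Φ t p O (KS.fT 0 fx)) q)) ≤ (concRadii2N (fcellsA κ Φ t p O.merged (gOf κ Φ t p O (KS.gT 0 gx)) (fOf κ Φ t p O (KS.fT 0 fx))) (Skelφ.Prm.gap ((SUA ex mx) κ Φ t p O.merged (gOf κ Φ t p O (KS.gT 0 gx)) (fOf κ Φ t p O (KS.fT 0 fx)) q)) (fun _ : ℕ => (0:ℕ)) (Skelφ.Prm.E₀ ((SUA ex mx) κ Φ t p O.merged (gOf κ Φ t p O (KS.gT 0 gx)) (fOf κ Φ t p O (KS.fT 0 fx)) q)) (Skelφ.Prm.Lp ((SUA ex mx) κ Φ t p O.merged (gOf κ Φ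 t p O (KS.gT 0 gx)) (fOf κ Φ t p O (KS.fT 0 fx)) q)) (offNA κ Φ t p O.merged (gOf κ Φ t p O (KS.gT 0 gx)) (fOf κ Φ t p O (KS.fT 0 fx)))).rM a' (x + stepVec du)) (hE : (Skelφ.Prm.Lp (SUA ex mx κ Φ t p O.merged (gOf κ Φ t p O (KS.gT 0 gx)) (fOf κ Φ t p O (KS.fT 0 fx)) q)) ≤ (concRadii2N (fcellsA κ Φ t p O.merged (gOf κ Φ t p O (KS.gT 0 gx)) (fOf κ Φ t p O (KS.fT 0 fx))) (Skelφ.Prm.gap ((SUA ex mx) κ Φ t p O.merged (gOf κ Φ t p O (KS.gT 0 gx)) (fOf κ Φ t p O (KS.fT 0 fx)) q)) (fun _ : ℕ => (0:ℕ)) (Skelφ.Prm.E₀ ((SUA ex mx) κ Φ t p O.merged (gOf κ Φ t p O (KS.gT 0 gx)) (fOf κ Φ t p O (KS.fT 0 fx)) q)) (Skelφ.Prm.Lp ((SUA ex mx) κ Φ t p O.merged (gOf κ Φ t p O (KS.gT 0 gx)) (fOf κ Φ t p O (KS.fT 0 fx)) q)) (offNA κ Φ t p O.merged (gOf κ Φ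 t p O (KS.gT 0 gx)) (fOf κ Φ t p O (KS.fT 0 fx)))).rE a' x du),
      0 + 1 + (numsY a' x du j pc c' hI hj yF hyF hpc h1 h2 hM hE).Nr + 1 + (numsY a' x du j pc c' hI hj yF hyF hpc h1 h2 hM hE).N₃ ≤ (NegB.nFA κ.K₀)) :
    Skelφ.FaceOblRM G ((choiceAtOTA κ Φ t p (KS.gT 0 gx) (KS.fT 0 fx) (SUA ex mx) hC (KS.PR 0 Px)).scheme O q)
      ((choiceAtOTA κ Φ t p (KS.gT 0 gx) (KS.fT 0 fx) (SUA ex mx) hC (KS.PR 0 Px)).FD O q) Φ.Δ κ.δ₂ := by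
  -- numbers and facts at `AtQO`
  have hNL : EqNumL κ Φ t p O.merged (gOf κ Φ t p O (KS.gT 0 gx)) (fOf κ Φ t p O (KS.fT 0 fx)) := eqNumL_of_atQOTA hAt
  obtain ⟨hnL1, hℓL1⟩ := one_le_of_eqNumL κ Φ t p O.merged (gOf κ Φ t p O (KS.gT 0 gx)) (fOf κ Φ t p O (KS.fT 0 fx)) hNL
  have hAtS := atQOS_of_atQOTA hAt
  have hAtB := atQOB_of_atQOTA hAt
  obtain ⟨hF, hq1, hq2, hCq⟩ := factsO_of_atQOTA hAt
  obtain ⟨-, -, hkM₀, hReq, hΛeq⟩ := hF.seed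
  have hκ10 : (hL κ Φ t p O.merged (gOf κ Φ t p O (KS.gT 0 gx)) (fOf κ Φ t p O (KS.fT 0 fx))).natAbs ≤ 10 * nL κ Φ t p O.merged (gOf κ Φ t p O (KS.gT 0 gx)) (fOf κ Φ t p O (KS.fT 0 fx)) := (clauseL_of_atQOTA hAt).2
  obtain ⟨hc₀, hc₁⟩ := prFA_c_pos κ Φ t p O.merged (gOf κ Φ t p O (KS.gT 0 gx)) (fOf κ Φ t p O (KS.fT 0 fx))
  have hDd := prFA_D κ Φ t p O.merged (gOf κ Φ t p O (KS.gT 0 gx)) (fOf κ Φ t p O (KS.fT 0 fx))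
  have hDpos : 0 < (prFA κ Φ t p O.merged (gOf κ Φ t p O (KS.gT 0 gx)) (fOf κ Φ t p O (KS.fT 0 fx))).D := by
    rw [(prFA_fields κ Φ t p O.merged (gOf κ Φ t p O (KS.gT 0 gx)) (fOf κ Φ t p O (KS.fT 0 fx))).2.2.2.2.2.2.2]; exact Skelφ.NegPrm.DofA_pos (Aof_pos κ).2 hnL1 hℓL1 _ _
  have hRl : (KS.RlevA κ Φ t p O.merged 0) ≤ KS.RA' κ Φ t p O.merged 0 := by rw [← (KS.RA'_eq κ Φ t p O.merged 0).2.1]; exact Nat.le_succ _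
  have hRA := KS.RA'_eq κ Φ t p O.merged 0
  have hs11 : ∀ i, 11 ≤ (fcellsA κ Φ t p O.merged (gOf κ Φ t p O (KS.gT 0 gx)) (fOf κ Φ t p O (KS.fT 0 fx))).s i := fun i => eleven_le_s_TA κ Φ t p O.merged (fOf κ Φ t p O (KS.fT 0 fx)) 0 gx hNL hκ10 i
  have hM := (prFA κ Φ t p O.merged (gOf κ Φ t p O (KS.gT 0 gx)) (fOf κ Φ t p O (KS.fT 0 fx))).Mabs_pos hc₀ hc₁ hDd hDpos
  -- p1-g13's room facts (layer (b) part 1, HOME/prim-bschramm-p1/lean-gen13/gen_negbta2.py)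
  have hfe : ∀ (du : MDir) (i : Fin 2), 0 ≤ (fcellsA κ Φ t p O.merged (gOf κ Φ t p O (KS.gT 0 gx)) (fOf κ Φ t p O (KS.fT 0 fx))).faceExt du i := fun du i => by
    unfold PCells2.faceExt; split_ifs <;> positivity
  have hrd : ∀ I b, 0 ≤ (prFA κ Φ t p O.merged (gOf κ Φ t p O (KS.gT 0 gx)) (fOf κ Φ t p O (KS.fT 0 fx))).rdK I b := fun I b => by
    unfold Skelφ.FinePrm.rdK; exact mul_nonneg ((prFA κ Φ t p O.merged (gOf κ Φ t p O (KS.gT 0 gx)) (fOf κ Φ t p O (KS.fT 0 fx))).cOf_pos hc₀ hc₁ I).le (abs_nonneg _)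
  have hawnn : ∀ du : MDir, 0 ≤ (prFA κ Φ t p O.merged (gOf κ Φ t p O (KS.gT 0 gx)) (fOf κ Φ t p O (KS.fT 0 fx))).awF₂ (fcellsA κ Φ t p O.merged (gOf κ Φ t p O (KS.gT 0 gx)) (fOf κ Φ t p O (KS.fT 0 fx))) du := fun du => by
    unfold Skelφ.FinePrm.awF₂ Skelφ.FinePrm.awNum
    apply Int.ediv_nonneg _ hM.le
    have h1 := hrd 1 ((prFA κ Φ t p O.merged (gOf κ Φ t p O (KS.gT 0 gx)) (fOf κ Φ t p O (KS.fT 0 fx))).bOf du.1); have h0 := hrd 0 ((prFA κ Φ t p O.merged (gOf κ Φ t p O (KS.gT 0 gx)) (fOf κ Φ t p O (KS.fT 0 fx))).bOf du.1); have e0 := hfe du 0; have e1 := hfe du 1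
    have : 0 ≤ ((prFA κ Φ t p O.merged (gOf κ Φ t p O (KS.gT 0 gx)) (fOf κ Φ t p O (KS.fT 0 fx))).rdK 1 ((prFA κ Φ t p O.merged (gOf κ Φ t p O (KS.gT 0 gx)) (fOf κ Φ t p O (KS.fT 0 fx))).bOf du.1) * ((fcellsA κ Φ t p O.merged (gOf κ Φ t p O (KS.gT 0 gx)) (fOf κ Φ t p O (KS.fT 0 fx))).faceExt du 0 + 1) + (prFA κ Φ t p O.merged (gOf κ Φ t p O (KS.gT 0 gx)) (fOf κ Φ t p O (KS.fT 0 fx))).rdK 0 ((prFA κ Φ t p O.merged (gOf κ Φ t p O (KS.gT 0 gx)) (fOf κ Φ t p O (KS.fT 0 fx))).bOf du.1) * ((fcellsA κ Φ t p O.merged (gOf κ Φ t p O (KS.gT 0 gx)) (fOf κ Φ t p O (KS.fT 0 fx))).faceExt du 1 + 1)) * (prFA κ Φ t p O.merged (gOf κ Φ t p O (KS.gT 0 gx)) (fOf κ Φ t p O (KS.fT 0 fx))).D := by positivity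
    linarith
  have hcount2 : 1 / (1 - (q : ℝ)) ^ (Φ.Δ * (KS.NkA κ Φ t p O.merged 0)) ≤ κ.δ₂ * ((Finset.Icc ((KS.j₀A t O.merged 0 - 1) + 1) (KS.RlevA κ Φ t p O.merged 0)).card : ℝ) := by
    have h := (KS.counts_R κ Φ t p O.merged 0 hp0 hp1 hq1 hq2 (Neg.δkit_le_δ₂ κ Φ)).2
    refine h.trans (mul_le_mul_of_nonneg_left ?_ κ.hδ₂0.le)
    have hsub : Finset.Icc (KS.j₀A t O.merged 0) (KS.j₁A κ Φ t p O.merged 0) ⊆ Finset.Icc ((KS.j₀A t O.merged 0 - 1) + 1) (KS.RlevA κ Φ t p O.merged 0) :=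
      Finset.Icc_subset_Icc (by have := (KS.le_T₀a t O.merged 0).2.2; unfold KS.j₀A; omega) (KS.RA'_eq κ Φ t p O.merged 0).2.2
    exact_mod_cast Finset.card_le_card hsub
  have hroomF2 : ∀ du : MDir, (prFA κ Φ t p O.merged (gOf κ Φ t p O (KS.gT 0 gx)) (fOf κ Φ t p O (KS.fT 0 fx))).Mabs * (((((prFA κ Φ t p O.merged (gOf κ Φ t p O (KS.gT 0 gx)) (fOf κ Φ t p O (KS.fT 0 fx))).awF₂ (fcellsA κ Φ t p O.merged (gOf κ Φ t p O (KS.gT 0 gx)) (fOf κ Φ t p O (KS.fT 0 fx))) du).toNat : ℕ) : ℤ) + ((KS.RlevA κ Φ t p O.merged 0) : ℤ) + 1) +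
      (prFA κ Φ t p O.merged (gOf κ Φ t p O (KS.gT 0 gx)) (fOf κ Φ t p O (KS.fT 0 fx))).rdN du.1 ((prFA κ Φ t p O.merged (gOf κ Φ t p O (KS.gT 0 gx)) (fOf κ Φ t p O (KS.fT 0 fx))).bOf du.1) * (((KS.RlevA κ Φ t p O.merged 0) : ℤ) + 2) * (prFA κ Φ t p O.merged (gOf κ Φ t p O (KS.gT 0 gx)) (fOf κ Φ t p O (KS.fT 0 fx))).D ≤ (prFA κ Φ t p O.merged (gOf κ Φ t p O (KS.gT 0 gx)) (fOf κ Φ t p O (KS.fT 0 fx))).rdK du.1 ((prFA κ Φ t p O.merged (gOf κ Φ t p O (KS.gT 0 gx)) (fOf κ Φ t p O (KS.fT 0 fx))).bOf du.1) * (prFA κ Φ t p O.merged (gOf κ Φ t p O (KS.gT 0 gx)) (fOf κ Φ t p O (KS.fT 0 fx))).kFF₂ (fcellsA κ Φ t p O.merged (gOf κ Φ t p O (KS.gT 0 gx)) (fOf κ Φ t p O (KS.fT 0 fx))) (KS.RlevA κ Φ t p O.merged 0) du.1 * (prFA κ Φ t p O.merged (gOf κ Φ t p O (KS.gT 0 gx))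 (fOf κ Φ t p O (KS.fT 0 fx))).D := fun du => by
    rw [Int.toNat_of_nonneg (hawnn du)]; exact (prFA κ Φ t p O.merged (gOf κ Φ t p O (KS.gT 0 gx)) (fOf κ Φ t p O (KS.fT 0 fx))).hroomF_kFF₂ hc₀ hc₁ hDd hDpos (fcellsA κ Φ t p O.merged (gOf κ Φ t p O (KS.gT 0 gx)) (fOf κ Φ t p O (KS.fT 0 fx))) (KS.RlevA κ Φ t p O.merged 0) du
  have haw2 : ∀ du : MDir, ((prFA κ Φ t p O.merged (gOf κ Φ t p O (KS.gT 0 gx)) (fOf κ Φ t p O (KS.fT 0 fx))).rdK 1 ((prFA κ Φ t p O.merged (gOf κ Φ t p O (KS.gT 0 gx)) (fOf κ Φ t p O (KS.fT 0 fx))).bOf du.1) * ((fcellsA κ Φ t p O.merged (gOf κ Φ t p O (KS.gT 0 gx)) (fOf κ Φ t p O (KS.fT 0 fx))).faceExt du 0 + 1) + (prFA κ Φ t p O.merged (gOf κ Φ t p O (KS.gT 0 gx)) (fOf κ Φ t p O (KS.fT 0 fx))).rdK 0 ((prFA κ Φ t p O.merged (gOf κ Φ t p O (KS.gT 0 gx))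 (fOf κ Φ t p O (KS.fT 0 fx))).bOf du.1) * ((fcellsA κ Φ t p O.merged (gOf κ Φ t p O (KS.gT 0 gx)) (fOf κ Φ t p O (KS.fT 0 fx))).faceExt du 1 + 1)) * (prFA κ Φ t p O.merged (gOf κ Φ t p O (KS.gT 0 gx)) (fOf κ Φ t p O (KS.fT 0 fx))).D ≤
      (prFA κ Φ t p O.merged (gOf κ Φ t p O (KS.gT 0 gx)) (fOf κ Φ t p O (KS.fT 0 fx))).Mabs * (((((prFA κ Φ t p O.merged (gOf κ Φ t p O (KS.gT 0 gx)) (fOf κ Φ t p O (KS.fT 0 fx))).awF₂ (fcellsA κ Φ t p O.merged (gOf κ Φ t p O (KS.gT 0 gx)) (fOf κ Φ t p O (KS.fT 0 fx))) du).toNat : ℕ) : ℤ) + 1) := fun du => by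
    rw [Int.toNat_of_nonneg (hawnn du)]; exact (prFA κ Φ t p O.merged (gOf κ Φ t p O (KS.gT 0 gx)) (fOf κ Φ t p O (KS.fT 0 fx))).haw_awF₂ hc₀ hc₁ hDd hDpos (fcellsA κ Φ t p O.merged (gOf κ Φ t p O (KS.gT 0 gx)) (fOf κ Φ t p O (KS.fT 0 fx))) du
  -- the residual floors at `ex` (stmt-g16's `floors_exA` through `exA ≤ ex`, plus the F pair's prism floor) and the kit radius `r := L′`
  obtain ⟨hexA, hexF⟩ := hex
  have hfl := floors_exA κ Φ t p O.merged (gOf κ Φ t p O (KS.gT 0 gx)) (fOf κ Φ t p O (KS.fT 0 fx))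
  have hLp : (ex κ Φ t p O.merged (gOf κ Φ t p O (KS.gT 0 gx)) (fOf κ Φ t p O (KS.fT 0 fx))) ≤ (Skelφ.Prm.Lp (SUA ex mx κ Φ t p O.merged (gOf κ Φ t p O (KS.gT 0 gx)) (fOf κ Φ t p O (KS.fT 0 fx)) q)) := (ex_le_Lp_UA κ Φ t p O.merged (gOf κ Φ t p O (KS.gT 0 gx)) (fOf κ Φ t p O (KS.fT 0 fx)) ex mx q).1
  have hLpeq := Lp_SUA_eq κ Φ t p O.merged (gOf κ Φ t p O (KS.gT 0 gx)) (fOf κ Φ t p O (KS.fT 0 fx)) ex mx q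
  have hex1 : 1 ≤ (ex κ Φ t p O.merged (gOf κ Φ t p O (KS.gT 0 gx)) (fOf κ Φ t p O (KS.fT 0 fx))) := by have := hfl.2.2.1; omega
  have hψ : ψπ Φ p O.merged = Skelφ.fatRadius Φ.frame hC O.merged.k := ψπ_eq Φ hC O.merged
  have hRexmono : Rex κ Φ (mRA κ Φ t p O.merged (gOf κ Φ t p O (KS.gT 0 gx)) (fOf κ Φ t p O (KS.fT 0 fx)) (mx κ Φ t p O.merged (gOf κ Φ t p O (KS.gT 0 gx)) (fOf κ Φ t p O (KS.fT 0 fx)))) q (Skelφ.fatRadius Φ.frame hC O.merged.k) ≤ Rex κ Φ (mRA κ Φ t p O.merged (gOf κ Φ t p O (KS.gT 0 gx)) (fOf κ Φ t p O (KS.fT 0 fx)) (mx κ Φ t p O.merged (gOf κ Φ t p O (KS.gT 0 gx)) (fOf κ Φ t p O (KS.fT 0 fx)))) q (2 * ψπ Φ p O.merged) :=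
    Rex_mono κ Φ _ q (by rw [hψ]; omega)
  have hr₀Rb := KS.r₀A_ge Φ t O.merged 0 (O.merged.R (O.merged.scale t (KS.MBF κ Φ t p O.merged cF 0) (KS.nBF κ Φ t p O.merged cF 0)))
  have hr₀Rl := KS.r₀A_ge Φ t O.merged 0 (O.merged.R (O.merged.scale t (ML κ Φ t p O.merged (gOf κ Φ t p O (KS.gT 0 gx))) (nL κ Φ t p O.merged (gOf κ Φ t p O (KS.gT 0 gx)) (fOf κ Φ t p O (KS.fT 0 fx)))))
  have hRs_le : KS.Rs t O.merged 0 ≤ KS.reachA t O.merged 0 := by unfold KS.reachA KS.da; omega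
  have hRlLp : (O.merged.R (O.merged.scale t (ML κ Φ t p O.merged (gOf κ Φ t p O (KS.gT 0 gx))) (nL κ Φ t p O.merged (gOf κ Φ t p O (KS.gT 0 gx)) (fOf κ Φ t p O (KS.fT 0 fx))))) ≤ (Skelφ.Prm.Lp (SUA ex mx κ Φ t p O.merged (gOf κ Φ t p O (KS.gT 0 gx)) (fOf κ Φ t p O (KS.fT 0 fx)) q)) := by have h := hfl.2.2.1; change NegB.Rl κ Φ t p O.merged (gOf κ Φ t p O (KS.gT 0 gx)) (fOf κ Φ t p O (KS.fT 0 fx)) + 1 ≤ _ at h; change NegB.Rl κ Φ t p O.merged (gOf κ Φ t p O (KS.gT 0 gx)) (fOf κ Φ t p O (KS.fT 0 fx)) ≤ _; omega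
  have hRr0 : (KS.apron Φ t O.merged 0 ((((Mu O.merged) + 1 : ℕ) : ℤ) * ((shearUnit (nL κ Φ t p O.merged (gOf κ Φ t p O (KS.gT 0 gx)) (fOf κ Φ t p O (KS.fT 0 fx))) (prFA κ Φ t p O.merged (gOf κ Φ t p O (KS.gT 0 gx)) (fOf κ Φ t p O (KS.fT 0 fx))).h) : ℤ) + 1) (KS.r₀A Φ t O.merged 0 (O.merged.R (O.merged.scale t (ML κ Φ t p O.merged (gOf κ Φ t p O (KS.gT 0 gx))) (nL κ Φ t p O.merged (gOf κ Φ t p O (KS.gT 0 gx)) (fOf κ Φ t p O (KS.fT 0 fx))))))).r₀ ≤ (Skelφ.Prm.Lp (SUA ex mx κ Φ t p O.merged (gOf κ Φ t p O (KS.gT 0 gx)) (fOf κ Φ t p O (KS.fT 0 fx)) q)) := by have h := hfl.2.1; change KS.r₀A Φ t O.merged 0 (NegB.Rl κ Φ t p O.merged (gOf κ Φ t p O (KS.gT 0 gx)) (fOf κ Φ t p O (KS.fT 0 fx))) + 1 ≤ _ at h; change KS.r₀A Φ t O.merged 0 (NegB.Rl κ Φ t p O.merged (gOf κ Φ t p O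 (KS.gT 0 gx)) (fOf κ Φ t p O (KS.fT 0 fx))) ≤ _; omega
  have hRb0 : (KS.apron Φ t O.merged 0 (((Mu O.merged : ℕ) : ℤ) + 2) (KS.r₀A Φ t O.merged 0 (O.merged.R (O.merged.scale t (KS.MBF κ Φ t p O.merged cF 0) (KS.nBF κ Φ t p O.merged cF 0))))).r₀ ≤ (Skelφ.Prm.Lp (SUA ex mx κ Φ t p O.merged (gOf κ Φ t p O (KS.gT 0 gx)) (fOf κ Φ t p O (KS.fT 0 fx)) q)) := by change KS.r₀A Φ t O.merged 0 (O.merged.R (O.merged.scale t (KS.MBF κ Φ t p O.merged cF 0) (KS.nBF κ Φ t p O.merged cF 0))) ≤ _; omega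
  have hRbLp : (O.merged.R (O.merged.scale t (KS.MBF κ Φ t p O.merged cF 0) (KS.nBF κ Φ t p O.merged cF 0))) ≤ (Skelφ.Prm.Lp (SUA ex mx κ Φ t p O.merged (gOf κ Φ t p O (KS.gT 0 gx)) (fOf κ Φ t p O (KS.fT 0 fx)) q)) := by have := hr₀Rb.2; omega
  have hRsLp : KS.Rs t O.merged 0 ≤ (Skelφ.Prm.Lp (SUA ex mx κ Φ t p O.merged (gOf κ Φ t p O (KS.gT 0 gx)) (fOf κ Φ t p O (KS.fT 0 fx)) q)) := by have := hfl.2.2.2.2.2.2.1; omega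
  have hR1b : Rex κ Φ (mRA κ Φ t p O.merged (gOf κ Φ t p O (KS.gT 0 gx)) (fOf κ Φ t p O (KS.fT 0 fx)) (mx κ Φ t p O.merged (gOf κ Φ t p O (KS.gT 0 gx)) (fOf κ Φ t p O (KS.fT 0 fx)))) q (Skelφ.fatRadius Φ.frame hC O.merged.k) ≤ (Skelφ.Prm.Lp (SUA ex mx κ Φ t p O.merged (gOf κ Φ t p O (KS.gT 0 gx)) (fOf κ Φ t p O (KS.fT 0 fx)) q)) - (KS.apron Φ t O.merged 0 (((Mu O.merged : ℕ) : ℤ) + 2) (KS.r₀A Φ t O.merged 0 (O.merged.R (O.merged.scale t (KS.MBF κ Φ t p O.merged cF 0) (KS.nBF κ Φ t p O.merged cF 0))))).r₀ := by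
    change _ ≤ _ - KS.r₀A Φ t O.merged 0 (O.merged.R (O.merged.scale t (KS.MBF κ Φ t p O.merged cF 0) (KS.nBF κ Φ t p O.merged cF 0))); omega
  have hR1r : Rex κ Φ (mRA κ Φ t p O.merged (gOf κ Φ t p O (KS.gT 0 gx)) (fOf κ Φ t p O (KS.fT 0 fx)) (mx κ Φ t p O.merged (gOf κ Φ t p O (KS.gT 0 gx)) (fOf κ Φ t p O (KS.fT 0 fx)))) q (Skelφ.fatRadius Φ.frame hC O.merged.k) ≤ (Skelφ.Prm.Lp (SUA ex mx κ Φ t p O.merged (gOf κ Φ t p O (KS.gT 0 gx)) (fOf κ Φ t p O (KS.fT 0 fx)) q)) - (KS.apron Φ t O.merged 0 ((((Mu O.merged) + 1 : ℕ) : ℤ) * ((shearUnit (nL κ Φ t p O.merged (gOf κ Φ t p O (KS.gT 0 gx)) (fOf κ Φ t p O (KS.fT 0 fx))) (prFA κ Φ t p O.merged (gOf κ Φ t p O (KS.gT 0 gx)) (fOf κ Φ t p O (KS.fT 0 fx))).h) : ℤ) + 1) (KS.r₀A Φ t O.merged 0 (O.merged.R (O.merged.scale t (ML κ Φ t p O.merged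 (gOf κ Φ t p O (KS.gT 0 gx))) (nL κ Φ t p O.merged (gOf κ Φ t p O (KS.gT 0 gx)) (fOf κ Φ t p O (KS.fT 0 fx))))))).r₀ := by
    have h := hfl.2.1; change KS.r₀A Φ t O.merged 0 (NegB.Rl κ Φ t p O.merged (gOf κ Φ t p O (KS.gT 0 gx)) (fOf κ Φ t p O (KS.fT 0 fx))) + 1 ≤ _ at h; change _ ≤ _ - KS.r₀A Φ t O.merged 0 (NegB.Rl κ Φ t p O.merged (gOf κ Φ t p O (KS.gT 0 gx)) (fOf κ Φ t p O (KS.fT 0 fx))); omega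
  have hρLp : Skelφ.fatRadius Φ.frame hC O.merged.k ≤ (Skelφ.Prm.Lp (SUA ex mx κ Φ t p O.merged (gOf κ Φ t p O (KS.gT 0 gx)) (fOf κ Φ t p O (KS.fT 0 fx)) q)) := by rw [← hψ]; omega
  have hr0L : (KS.apron Φ t O.merged 0 ((((Mu O.merged) + 1 : ℕ) : ℤ) * (prFA κ Φ t p O.merged (gOf κ Φ t p O (KS.gT 0 gx)) (fOf κ Φ t p O (KS.fT 0 fx))).D + 1) (KS.r₀A Φ t O.merged 0 (Skelφ.Prm.Lp (SUA ex mx κ Φ t p O.merged (gOf κ Φ t p O (KS.gT 0 gx)) (fOf κ Φ t p O (KS.fT 0 fx)) q)))).r₀ + 1 ≤ 2 * (Skelφ.Prm.Lp (SUA ex mx κ Φ t p O.merged (gOf κ Φ t p O (KS.gT 0 gx)) (fOf κ Φ t p O (KS.fT 0 fx)) q)) := by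
    change KS.r₀A Φ t O.merged 0 (Skelφ.Prm.Lp (SUA ex mx κ Φ t p O.merged (gOf κ Φ t p O (KS.gT 0 gx)) (fOf κ Φ t p O (KS.fT 0 fx)) q)) + 1 ≤ _
    have h1 := hr₀Rl.1; have h2 := hr₀Rl.2; have h3 := hfl.2.1
    change KS.r₀A Φ t O.merged 0 (NegB.Rl κ Φ t p O.merged (gOf κ Φ t p O (KS.gT 0 gx)) (fOf κ Φ t p O (KS.fT 0 fx))) + 1 ≤ _ at h3
    unfold KS.r₀A at h1 h2 ⊢; omega
  -- the scheme excess at the face diameter `mRA mx` (G4)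
  have hη2 : Neg.η κ Φ ≤ κ.δ / 2 := le_trans (Neg.η_pos κ Φ).2.1 (by linarith [Neg.δkit_le_δ κ Φ])
  have hmF : (prFA κ Φ t p O.merged (gOf κ Φ t p O (KS.gT 0 gx)) (fOf κ Φ t p O (KS.fT 0 fx))).mF (fcellsA κ Φ t p O.merged (gOf κ Φ t p O (KS.gT 0 gx)) (fOf κ Φ t p O (KS.fT 0 fx))) ≤ (((mRA κ Φ t p O.merged (gOf κ Φ t p O (KS.gT 0 gx)) (fOf κ Φ t p O (KS.fT 0 fx)) (mx κ Φ t p O.merged (gOf κ Φ t p O (KS.gT 0 gx)) (fOf κ Φ t p O (KS.fT 0 fx)))) : ℕ) : ℤ) := hmx.trans (by exact_mod_cast (mRA_ge κ Φ t p O.merged (gOf κ Φ t p O (KS.gT 0 gx)) (fOf κ Φ t p O (KS.fT 0 fx)) (mx κ Φ t p O.merged (gOf κ Φ t p O (KS.gT 0 gx)) (fOf κ Φ t p O (KS.fT 0 fx)))).2)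
  have hdiamA : ∀ b' : Fin 2, ((prFA κ Φ t p O.merged (gOf κ Φ t p O (KS.gT 0 gx)) (fOf κ Φ t p O (KS.fT 0 fx))).rdK 1 b' + (prFA κ Φ t p O.merged (gOf κ Φ t p O (KS.gT 0 gx)) (fOf κ Φ t p O (KS.fT 0 fx))).rdK 0 b') * ((50 * (fcellsA κ Φ t p O.merged (gOf κ Φ t p O (KS.gT 0 gx)) (fOf κ Φ t p O (KS.fT 0 fx))).rmax : ℕ) + 1) * (prFA κ Φ t p O.merged (gOf κ Φ t p O (KS.gT 0 gx)) (fOf κ Φ t p O (KS.fT 0 fx))).D ≤ (prFA κ Φ t p O.merged (gOf κ Φ t p O (KS.gT 0 gx)) (fOf κ Φ t p O (KS.fT 0 fx))).Mabs * (((mRA κ Φ t p O.merged (gOf κ Φ t p O (KS.gT 0 gx)) (fOf κ Φ t p O (KS.fT 0 fx)) (mx κ Φ t p O.merged (gOf κ Φ t p O (KS.gT 0 gx)) (fOf κ Φ t p O (KS.fT 0 fx)))) : ℕ) + 1) := fun b' =>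
    le_trans ((prFA κ Φ t p O.merged (gOf κ Φ t p O (KS.gT 0 gx)) (fOf κ Φ t p O (KS.fT 0 fx))).hdiam_mF hc₀ hc₁ hDd hDpos (fcellsA κ Φ t p O.merged (gOf κ Φ t p O (KS.gT 0 gx)) (fOf κ Φ t p O (KS.fT 0 fx))) b') (mul_le_mul_of_nonneg_left (by linarith) hM.le)
  -- run boxes are boxes (G11)
  have hcoreX : ∀ (R' q' N' k : ℕ), k ≤ N' → (xRunSched (nL κ Φ t p O.merged (gOf κ Φ t p O (KS.gT 0 gx)) (fOf κ Φ t p O (KS.fT 0 fx))) (ℓL κ Φ t p O.merged (gOf κ Φ t p O (KS.gT 0 gx)) (fOf κ Φ t p O (KS.fT 0 fx))) (prFA κ Φ t p O.merged (gOf κ Φ t p O (KS.gT 0 gx)) (fOf κ Φ t p O (KS.fT 0 fx))).h R' q' N').lo k ≤ (xRunSched (nL κ Φ t p O.merged (gOf κ Φ t p O (KS.gT 0 gx)) (fOf κ Φ t p O (KS.fT 0 fx))) (ℓL κ Φ t p O.merged (gOf κ Φ t p O (KS.gT 0 gx)) (fOf κ Φ t p O (KS.fT 0 fx))) (prFA κ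 Φ t p O.merged (gOf κ Φ t p O (KS.gT 0 gx)) (fOf κ Φ t p O (KS.fT 0 fx))).h R' q' N').hi k :=
    fun R' q' N' k hk => Finset.nonempty_Icc.1 ((xRunSched (nL κ Φ t p O.merged (gOf κ Φ t p O (KS.gT 0 gx)) (fOf κ Φ t p O (KS.fT 0 fx))) (ℓL κ Φ t p O.merged (gOf κ Φ t p O (KS.gT 0 gx)) (fOf κ Φ t p O (KS.fT 0 fx))) (prFA κ Φ t p O.merged (gOf κ Φ t p O (KS.gT 0 gx)) (fOf κ Φ t p O (KS.fT 0 fx))).h R' q' N').nonempty k (by change k ≤ N' + 1; omega))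
  have hcoreY : ∀ (R' q' N' k : ℕ), k ≤ N' → (yRunSched hnL hvL hlay R' q' N').lo k ≤ (yRunSched hnL hvL hlay R' q' N').hi k :=
    fun R' q' N' k hk => Finset.nonempty_Icc.1 ((yRunSched hnL hvL hlay R' q' N').nonempty k (by change k ≤ N' + 1; omega))
  -- the zone clearance and the zone inside the long prism (G12)
  have hclrz2 : ((Mu O.merged) + 4) * ((nL κ Φ t p O.merged (gOf κ Φ t p O (KS.gT 0 gx)) (fOf κ Φ t p O (KS.fT 0 fx))) + (prFA κ Φ t p O.merged (gOf κ Φ t p O (KS.gT 0 gx)) (fOf κ Φ t p O (KS.fT 0 fx))).h.natAbs) ≤ (nL κ Φ t p O.merged (gOf κ Φ t p O (KS.gT 0 gx)) (fOf κ Φ t p O (KS.fT 0 fx))) * ((ℓL κ Φ t p O.merged (gOf κ Φ t p O (KS.gT 0 gx)) (fOf κ Φ t p O (KS.fT 0 fx))) + 1) := by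
    have h : ((Mu O.merged : ℤ) + 4) * (((nL κ Φ t p O.merged (gOf κ Φ t p O (KS.gT 0 gx)) (fOf κ Φ t p O (KS.fT 0 fx))) : ℤ) + |hL κ Φ t p O.merged (gOf κ Φ t p O (KS.gT 0 gx)) (fOf κ Φ t p O (KS.fT 0 fx))|) ≤ ((nL κ Φ t p O.merged (gOf κ Φ t p O (KS.gT 0 gx)) (fOf κ Φ t p O (KS.fT 0 fx))) : ℤ) * (((ℓL κ Φ t p O.merged (gOf κ Φ t p O (KS.gT 0 gx)) (fOf κ Φ t p O (KS.fT 0 fx))) : ℤ) + 1) :=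
      KS.hclrz_T κ Φ t p O.merged 0 gx (fOf κ Φ t p O (KS.fT 0 fx)) hNL hκ10
    have key : ∀ (Mu n ℓ : ℕ) (hh : ℤ), ((Mu : ℤ) + 4) * ((n : ℤ) + |hh|) ≤ (n : ℤ) * ((ℓ : ℤ) + 1) → (Mu + 4) * (n + hh.natAbs) ≤ n * (ℓ + 1) :=
      fun Mu n ℓ hh hle => by
        have h' : (((Mu + 4) * (n + hh.natAbs) : ℕ) : ℤ) ≤ ((n * (ℓ + 1) : ℕ) : ℤ) := by push_cast [Int.natCast_natAbs]; linarith
        exact_mod_cast h'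
    exact key _ _ _ _ h
  have hkMu : O.merged.k ≤ Mu O.merged := hkM₀
  have hMuML : Mu O.merged ≤ ML κ Φ t p O.merged (gOf κ Φ t p O (KS.gT 0 gx)) := Mu_le_ML κ Φ t p O.merged (gOf κ Φ t p O (KS.gT 0 gx))
  have hMLnL := (ML_lt_nL κ Φ t p O.merged (gOf κ Φ t p O (KS.gT 0 gx)) (fOf κ Φ t p O (KS.fT 0 fx))).1
  have hℓT : 22000 * (((KS.RA' κ Φ t p O.merged 0 : ℕ) : ℤ) + 2) + 1 ≤ (((ℓL κ Φ t p O.merged (gOf κ Φ t p O (KS.gT 0 gx)) (fOf κ Φ t p O (KS.fT 0 fx))) : ℕ) : ℤ) := KS.ℓL_ge_T κ Φ t p O.merged 0 gx (fOf κ Φ t p O (KS.fT 0 fx)) hNL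
  have hZU2 : ∀ c', O.merged.Λ c' O.merged.k ⊆ pgramPrismFin G (φL κ Φ t p O.D O.DT O.ori (gOf κ Φ t p O (KS.gT 0 gx)) (fOf κ Φ t p O (KS.fT 0 fx))) c' (nL κ Φ t p O.merged (gOf κ Φ t p O (KS.gT 0 gx)) (fOf κ Φ t p O (KS.fT 0 fx))) (prFA κ Φ t p O.merged (gOf κ Φ t p O (KS.gT 0 gx)) (fOf κ Φ t p O (KS.fT 0 fx))).h (3 * (ℓL κ Φ t p O.merged (gOf κ Φ t p O (KS.gT 0 gx)) (fOf κ Φ t p O (KS.fT 0 fx)))) (O.merged.R (O.merged.scale t (ML κ Φ t p O.merged (gOf κ Φ t p O (KS.gT 0 gx))) (nL κ Φ t p O.merged (gOf κ Φ t p O (KS.gT 0 gx)) (fOf κ Φ t p O (KS.fT 0 fx))))) := by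
    intro c'
    rw [hΛeq]
    have hKC : 11 * Mu O.merged ≤ KS.reachA t O.merged 0 := by unfold KS.reachA KS.KCmax; omega
    have hreach : KS.reachA t O.merged 0 ≤ KS.RA' κ Φ t p O.merged 0 := by have := hRA.1; omega
    have hℓT' : 22000 * (KS.RA' κ Φ t p O.merged 0 + 2) + 1 ≤ (ℓL κ Φ t p O.merged (gOf κ Φ t p O (KS.gT 0 gx)) (fOf κ Φ t p O (KS.fT 0 fx))) := by
      have h := hℓT; exact_mod_cast h
    have hℓ : 11 * O.merged.k ≤ 3 * (ℓL κ Φ t p O.merged (gOf κ Φ t p O (KS.gT 0 gx)) (fOf κ Φ t p O (KS.fT 0 fx))) := by omega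
    have hR : Skelφ.fatRadius Φ.frame hC O.merged.k ≤ (O.merged.R (O.merged.scale t (ML κ Φ t p O.merged (gOf κ Φ t p O (KS.gT 0 gx))) (nL κ Φ t p O.merged (gOf κ Φ t p O (KS.gT 0 gx)) (fOf κ Φ t p O (KS.fT 0 fx))))) := by
      rw [hReq]; exact Skelφ.fatRadius_mono Φ.frame hC (le_trans (by omega) (le_max_left _ _))
    exact Skelφ.fatSeq_subset_pgramPrismFin Φ.frame hC _ (by omega) hκ10 hℓ hR
  -- the face table (G10): C := 2M_u + 12, k_L := M_u + 4 at M_K = 24M_u + 63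
  have hcLup := fun I => cL_upperA κ Φ t p O.merged (gOf κ Φ t p O (KS.gT 0 gx)) (fOf κ Φ t p O (KS.fT 0 fx)) hNL I
  have hcLlo := fun I => cL_lowerA κ Φ t p O.merged (gOf κ Φ t p O (KS.gT 0 gx)) (fOf κ Φ t p O (KS.fT 0 fx)) hNL I (hs11 I)
  have hlv : ∀ (I b : Fin 2), |(prFA κ Φ t p O.merged (gOf κ Φ t p O (KS.gT 0 gx)) (fOf κ Φ t p O (KS.fT 0 fx))).lvGen I b| ≤ |(prFA κ Φ t p O.merged (gOf κ Φ t p O (KS.gT 0 gx)) (fOf κ Φ t p O (KS.fT 0 fx))).lvGen I 0| + |(prFA κ Φ t p O.merged (gOf κ Φ t p O (KS.gT 0 gx)) (fOf κ Φ t p O (KS.fT 0 fx))).lvGen I 1| := fun I b => by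
    fin_cases b
    · exact le_add_of_nonneg_right (abs_nonneg _)
    · exact le_add_of_nonneg_left (abs_nonneg _)
  have hclimb : ∀ I, (prFA κ Φ t p O.merged (gOf κ Φ t p O (KS.gT 0 gx)) (fOf κ Φ t p O (KS.fT 0 fx))).climC I ((prFA κ Φ t p O.merged (gOf κ Φ t p O (KS.gT 0 gx)) (fOf κ Φ t p O (KS.fT 0 fx))).bOf I) I ≤ (prFA κ Φ t p O.merged (gOf κ Φ t p O (KS.gT 0 gx)) (fOf κ Φ t p O (KS.fT 0 fx))).cOf I * (prFA κ Φ t p O.merged (gOf κ Φ t p O (KS.gT 0 gx)) (fOf κ Φ t p O (KS.fT 0 fx))).L I := fun I => by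
    unfold Skelφ.FinePrm.climC Skelφ.FinePrm.L
    rw [if_pos rfl]
    have hc := ((prFA κ Φ t p O.merged (gOf κ Φ t p O (KS.gT 0 gx)) (fOf κ Φ t p O (KS.fT 0 fx))).cOf_pos hc₀ hc₁ I).le
    calc (prFA κ Φ t p O.merged (gOf κ Φ t p O (KS.gT 0 gx)) (fOf κ Φ t p O (KS.fT 0 fx))).cOf I * |(prFA κ Φ t p O.merged (gOf κ Φ t p O (KS.gT 0 gx)) (fOf κ Φ t p O (KS.fT 0 fx))).A| * |(prFA κ Φ t p O.merged (gOf κ Φ t p O (KS.gT 0 gx)) (fOf κ Φ t p O (KS.fT 0 fx))).lvGen I ((prFA κ Φ t p O.merged (gOf κ Φ t p O (KS.gT 0 gx)) (fOf κ Φ t p O (KS.fT 0 fx))).bOf I)|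
        ≤ (prFA κ Φ t p O.merged (gOf κ Φ t p O (KS.gT 0 gx)) (fOf κ Φ t p O (KS.fT 0 fx))).cOf I * |(prFA κ Φ t p O.merged (gOf κ Φ t p O (KS.gT 0 gx)) (fOf κ Φ t p O (KS.fT 0 fx))).A| * (|(prFA κ Φ t p O.merged (gOf κ Φ t p O (KS.gT 0 gx)) (fOf κ Φ t p O (KS.fT 0 fx))).lvGen I 0| + |(prFA κ Φ t p O.merged (gOf κ Φ t p O (KS.gT 0 gx)) (fOf κ Φ t p O (KS.fT 0 fx))).lvGen I 1|) := mul_le_mul_of_nonneg_left (hlv I _) (mul_nonneg hc (abs_nonneg _))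
      _ = (prFA κ Φ t p O.merged (gOf κ Φ t p O (KS.gT 0 gx)) (fOf κ Φ t p O (KS.fT 0 fx))).cOf I * (|(prFA κ Φ t p O.merged (gOf κ Φ t p O (KS.gT 0 gx)) (fOf κ Φ t p O (KS.fT 0 fx))).A| * (|(prFA κ Φ t p O.merged (gOf κ Φ t p O (KS.gT 0 gx)) (fOf κ Φ t p O (KS.fT 0 fx))).lvGen I 0| + |(prFA κ Φ t p O.merged (gOf κ Φ t p O (KS.gT 0 gx)) (fOf κ Φ t p O (KS.fT 0 fx))).lvGen I 1|)) := by ring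
  have hAface : (KS.apron Φ t O.merged 0 ((((Mu O.merged) + 1 : ℕ) : ℤ) * (prFA κ Φ t p O.merged (gOf κ Φ t p O (KS.gT 0 gx)) (fOf κ Φ t p O (KS.fT 0 fx))).D + 1) (KS.r₀A Φ t O.merged 0 (Skelφ.Prm.Lp (SUA ex mx κ Φ t p O.merged (gOf κ Φ t p O (KS.gT 0 gx)) (fOf κ Φ t p O (KS.fT 0 fx)) q)))).A = (((Mu O.merged) + 1 : ℕ) : ℤ) * (prFA κ Φ t p O.merged (gOf κ Φ t p O (KS.gT 0 gx)) (fOf κ Φ t p O (KS.fT 0 fx))).D + 1 := rfl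
  have hexitR2 : (KS.apron Φ t O.merged 0 ((((Mu O.merged) + 1 : ℕ) : ℤ) * (prFA κ Φ t p O.merged (gOf κ Φ t p O (KS.gT 0 gx)) (fOf κ Φ t p O (KS.fT 0 fx))).D + 1) (KS.r₀A Φ t O.merged 0 (Skelφ.Prm.Lp (SUA ex mx κ Φ t p O.merged (gOf κ Φ t p O (KS.gT 0 gx)) (fOf κ Φ t p O (KS.fT 0 fx)) q)))).A + 2 * (prFA κ Φ t p O.merged (gOf κ Φ t p O (KS.gT 0 gx)) (fOf κ Φ t p O (KS.fT 0 fx))).D ≤ ((2 * Mu O.merged + 12) : ℤ) * (prFA κ Φ t p O.merged (gOf κ Φ t p O (KS.gT 0 gx)) (fOf κ Φ t p O (KS.fT 0 fx))).D := by rw [hAface]; exact faceTable_arithR _ _ hDpos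
  have hexitL2 : ∀ I, (KS.apron Φ t O.merged 0 ((((Mu O.merged) + 1 : ℕ) : ℤ) * (prFA κ Φ t p O.merged (gOf κ Φ t p O (KS.gT 0 gx)) (fOf κ Φ t p O (KS.fT 0 fx))).D + 1) (KS.r₀A Φ t O.merged 0 (Skelφ.Prm.Lp (SUA ex mx κ Φ t p O.merged (gOf κ Φ t p O (KS.gT 0 gx)) (fOf κ Φ t p O (KS.fT 0 fx)) q)))).A + (prFA κ Φ t p O.merged (gOf κ Φ t p O (KS.gT 0 gx)) (fOf κ Φ t p O (KS.fT 0 fx))).climC I ((prFA κ Φ t p O.merged (gOf κ Φ t p O (KS.gT 0 gx)) (fOf κ Φ t p O (KS.fT 0 fx))).bOf I) I + (prFA κ Φ t p O.merged (gOf κ Φ t p O (KS.gT 0 gx)) (fOf κ Φ t p O (KS.fT 0 fx))).D ≤ (((Mu O.merged : ℕ) : ℤ) + 4) * (prFA κ Φ t p O.merged (gOf κ Φ t p O (KS.gT 0 gx)) (fOf κ Φ t p O (KS.fT 0 fx))).D := fun I => by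
    rw [hAface]; exact faceTable_arithL _ _ _ _ hDpos (hclimb I) (hcLup I)
  have hkC2 : ∀ I, ((((Mu O.merged : ℕ) : ℤ) + 4) + 1) * (prFA κ Φ t p O.merged (gOf κ Φ t p O (KS.gT 0 gx)) (fOf κ Φ t p O (KS.fT 0 fx))).D ≤ ((2 * Mu O.merged + 12) : ℤ) * ((prFA κ Φ t p O.merged (gOf κ Φ t p O (KS.gT 0 gx)) (fOf κ Φ t p O (KS.fT 0 fx))).cOf I * (prFA κ Φ t p O.merged (gOf κ Φ t p O (KS.gT 0 gx)) (fOf κ Φ t p O (KS.fT 0 fx))).L I) := fun I =>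
    faceTable_arithC _ _ _ hDpos (hcLlo I)
  -- the kit pair's table, served at accuracy δ₂ (the face kit's exits)
  have hPk := KS.kit_mem_PR κ Φ t p O.merged 0 Px
  have hQKf := fun c' => KS.QKO_facts κ Φ t p O.D O.DT O.ori (gOf κ Φ t p O (KS.gT 0 gx)) (fOf κ Φ t p O (KS.fT 0 fx)) 0 c'
  have hQ : ∀ c', (KS.QKO κ Φ t p O.D O.DT O.ori (gOf κ Φ t p O (KS.gT 0 gx)) (fOf κ Φ t p O (KS.fT 0 fx)) 0).nS c' = KS.nKit O.merged 0 ∧ (KS.QKO κ Φ t p O.D O.DT O.ori (gOf κ Φ t p O (KS.gT 0 gx)) (fOf κ Φ t p O (KS.fT 0 fx)) 0).hS c' = O.merged.hgt t (KS.MK O.merged 0) (KS.nKit O.merged 0) ∧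
      (KS.QKO κ Φ t p O.D O.DT O.ori (gOf κ Φ t p O (KS.gT 0 gx)) (fOf κ Φ t p O (KS.fT 0 fx)) 0).ℓS c' = O.merged.len t (KS.MK O.merged 0) (KS.nKit O.merged 0) ∧
      (KS.QKO κ Φ t p O.D O.DT O.ori (gOf κ Φ t p O (KS.gT 0 gx)) (fOf κ Φ t p O (KS.fT 0 fx)) 0).RS c' = O.merged.R (O.merged.scale t (KS.MK O.merged 0) (KS.nKit O.merged 0)) ∧
      (KS.QKO κ Φ t p O.D O.DT O.ori (gOf κ Φ t p O (KS.gT 0 gx)) (fOf κ Φ t p O (KS.fT 0 fx)) 0).vS c' = O.merged.spl t (KS.MK O.merged 0) (KS.nKit O.merged 0) := fun c' => ⟨rfl, rfl, rfl, rfl, rfl⟩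
  have hδI22 : Neg.δI κ Φ ≤ κ.δ₂ ^ 2 := Neg.δI_le_sq_of_le κ Φ (Neg.δkit_le_δ₂ κ Φ)
  have hservedK2 : ∀ (c' : V) (fam : Fin 2) (σ' τ' : ℤˣ), 1 - κ.δ₂ ^ 2 < (bondPercolation G q).real
      (linkIn (Skelφ.StepI.regionNAt G (oriφ (φL κ Φ t p O.D O.DT O.ori (gOf κ Φ t p O (KS.gT 0 gx)) (fOf κ Φ t p O (KS.fT 0 fx))) ((KS.QKO κ Φ t p O.D O.DT O.ori (gOf κ Φ t p O (KS.gT 0 gx)) (fOf κ Φ t p O (KS.fT 0 fx)) 0).oS c')) O.merged t c' (KS.MK O.merged 0) (KS.nKit O.merged 0))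
        (O.merged.Λ c' O.merged.k) (Skelφ.StepI.pieceNAt G (oriφ (φL κ Φ t p O.D O.DT O.ori (gOf κ Φ t p O (KS.gT 0 gx)) (fOf κ Φ t p O (KS.fT 0 fx))) ((KS.QKO κ Φ t p O.D O.DT O.ori (gOf κ Φ t p O (KS.gT 0 gx)) (fOf κ Φ t p O (KS.fT 0 fx)) 0).oS c')) O.merged t c' (KS.MK O.merged 0) (KS.nKit O.merged 0) fam σ' τ')) := by
    intro c' fam σ' τ'
    have h := inputsExtraAt_of_atQOB hAtB h1 c' hPk fam σ' τ'
    rw [Skelφ.StepI.eventNAt_some] at h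
    have hmap : oriφ (φL κ Φ t p O.D O.DT O.ori (gOf κ Φ t p O (KS.gT 0 gx)) (fOf κ Φ t p O (KS.fT 0 fx))) ((KS.QKO κ Φ t p O.D O.DT O.ori (gOf κ Φ t p O (KS.gT 0 gx)) (fOf κ Φ t p O (KS.fT 0 fx)) 0).oS c') = oriφ Φ.φ (O.ori t (KS.MK O.merged 0) (KS.nKit O.merged 0)) := by
      rw [(hQKf c').2.2.2.2.2, KS.oriφ_φL_oS]; rfl
    rw [hmap]
    exact lt_of_le_of_lt (by linarith [hδI22]) h
  have hexitK2 : ∀ (I : Fin 2) (c' : V) (i : Fin 2) (σ₀ : ℤˣ), 1 - κ.δ₂ ^ 2 < (bondPercolation G q).real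
      (linkIn (↑(RgO G (φL κ Φ t p O.D O.DT O.ori (gOf κ Φ t p O (KS.gT 0 gx)) (fOf κ Φ t p O (KS.fT 0 fx))) (KS.QKO κ Φ t p O.D O.DT O.ori (gOf κ Φ t p O (KS.gT 0 gx)) (fOf κ Φ t p O (KS.fT 0 fx)) 0) c') : Set V) (O.merged.Λ c' O.merged.k) ((prFA κ Φ t p O.merged (gOf κ Φ t p O (KS.gT 0 gx)) (fOf κ Φ t p O (KS.fT 0 fx))).pexFO G (φL κ Φ t p O.D O.DT O.ori (gOf κ Φ t p O (KS.gT 0 gx)) (fOf κ Φ t p O (KS.fT 0 fx))) I ((prFA κ Φ t p O.merged (gOf κ Φ t p O (KS.gT 0 gx)) (fOf κ Φ t p O (KS.fT 0 fx))).bOf I) (KS.QKO κ Φ t p O.D O.DT O.ori (gOf κ Φ t p O (KS.gT 0 gx)) (fOf κ Φ t p O (KS.fT 0 fx)) 0) (2 * Mu O.merged + 12) i σ₀ c')) := by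
    intro I c' i σ₀
    have he : (σ₀ : ℤ) = 1 ∨ (σ₀ : ℤ) = -1 := by rcases Int.units_eq_one_or σ₀ with h | h <;> simp [h]
    exact Skelφ.real_pexVL_gt (φ := (φL κ Φ t p O.D O.DT O.ori (gOf κ Φ t p O (KS.gT 0 gx)) (fOf κ Φ t p O (KS.fT 0 fx)))) (Λ := O.merged.Λ) (k := O.merged.k) hQ hservedK2 (2 * Mu O.merged + 12) _ _ he c'
  exact faceOblRM_negBTC₁ (c := (cOffA κ Φ t p O.merged (gOf κ Φ t p O (KS.gT 0 gx)) (fOf κ Φ t p O (KS.fT 0 fx)))) (k₀ := (3 : ℤ)) (kF := (fun I => (prFA κ Φ t p O.merged (gOf κ Φ t p O (KS.gT 0 gx)) (fOf κ Φ t p O (KS.fT 0 fx))).kFF₂ (fcellsA κ Φ t p O.merged (gOf κ Φ t p O (KS.gT 0 gx)) (fOf κ Φ t p O (KS.fT 0 fx))) (KS.RlevA κ Φ t p O.merged 0) I)) (η := (κ.δ / 2)) (m := (mRA κ Φ t p O.merged (gOf κ Φ t p O (KS.gT 0 gx)) (fOf κ Φ t p O (KS.fT 0 fx)) (mx κ Φ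 t p O.merged (gOf κ Φ t p O (KS.gT 0 gx)) (fOf κ Φ t p O (KS.fT 0 fx))))) (nFc := (fun I => ((prFA κ Φ t p O.merged (gOf κ Φ t p O (KS.gT 0 gx)) (fOf κ Φ t p O (KS.fT 0 fx))).cOf I * |(prFA κ Φ t p O.merged (gOf κ Φ t p O (KS.gT 0 gx)) (fOf κ Φ t p O (KS.fT 0 fx))).A| * |(prFA κ Φ t p O.merged (gOf κ Φ t p O (KS.gT 0 gx)) (fOf κ Φ t p O (KS.fT 0 fx))).lvGen I ((prFA κ Φ t p O.merged (gOf κ Φ t p O (KS.gT 0 gx)) (fOf κ Φ t p O (KS.fT 0 fx))).bOf I)|).toNat)) (E := (KS.RlevA κ Φ t p O.merged 0 + KS.reachA t O.merged 0)) (r := (Skelφ.Prm.Lp (SUA ex mx κ Φ t p O.merged (gOf κ Φ t p O (KS.gT 0 gx)) (fOf κ Φ t p O (KS.fT 0 fx)) q))) (kb := (Mu O.merged)) (C := (2 * Mu O.merged + 12)) (MK := (KS.MK O.merged 0)) (kL := (fun _ : Fin 2 => ((Mu O.merged : ℕ) : ℤ) + 4)) hAt h1 hp0 hp1 0 (KS.kit_mem_PR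 κ Φ t p O.merged 0 Px) (O.merged.R (O.merged.scale t (KS.MBF κ Φ t p O.merged cF 0) (KS.nBF κ Φ t p O.merged cF 0))) (KS.hΛRg_of_atQOS 0 hAtS) (fun n => le_trans hex1 (le_trans hLp (hgapL_UA κ Φ t p O.merged _ _ ex mx q n))) (hgap20_UA κ Φ t p O.merged (gOf κ Φ t p O (KS.gT 0 gx)) (fOf κ Φ t p O (KS.fT 0 fx)) ex mx q) (hgapc_UA κ Φ t p O.merged (gOf κ Φ t p O (KS.gT 0 gx)) (fOf κ Φ t p O (KS.fT 0 fx)) ex mx q) (le_trans (by norm_num) (three_le_E₀_UA κ Φ t p O.merged (gOf κ Φ t p O (KS.gT 0 gx)) (fOf κ Φ t p O (KS.fT 0 fx)) ex mx q).1) (le_trans hex1 hLp) (offNA_le κ Φ t p O.merged (gOf κ Φ t p O (KS.gT 0 gx)) (fOf κ Φ t p O (KS.fT 0 fx)) hNL hκ10) (hoffNA_at κ Φ t p O.merged (gOf κ Φ t p O (KS.gT 0 gx)) (fOf κ Φ t p O (KS.fT 0 fx))) (KS.RlevA κ Φ t p O.merged 0) (KS.NkA κ Φ t p O.merged 0) (KS.j₀A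 t O.merged 0 - 1) (fun i => (hRlev_RA κ Φ t p O.merged (fOf κ Φ t p O (KS.fT 0 fx)) 0 gx hNL hκ10 i).1) (fun i => (hRlev_RA κ Φ t p O.merged (fOf κ Φ t p O (KS.fT 0 fx)) 0 gx hNL hκ10 i).2) (fun du : MDir => ((prFA κ Φ t p O.merged (gOf κ Φ t p O (KS.gT 0 gx)) (fOf κ Φ t p O (KS.fT 0 fx))).awF₂ (fcellsA κ Φ t p O.merged (gOf κ Φ t p O (KS.gT 0 gx)) (fOf κ Φ t p O (KS.fT 0 fx))) du).toNat) (fun I => rdN_le_three_rdKA κ Φ t p O.merged (gOf κ Φ t p O (KS.gT 0 gx)) (fOf κ Φ t p O (KS.fT 0 fx)) hNL I (hs11 I)) (fun i => hk₀'_RA κ Φ t p O.merged (fOf κ Φ t p O (KS.fT 0 fx)) 0 gx hNL hκ10 (le_refl (3 : ℤ)) i) hroomF2 (fun I => hkF_RA κ Φ t p O.merged (fOf κ Φ t p O (KS.fT 0 fx)) 0 gx hNL hκ10 hRl I) haw2 hcount2 le_rfl (Rex κ Φ (mRA κ Φ t p O.merged (gOf κ Φ t p O (KS.gT 0 gx))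 (fOf κ Φ t p O (KS.fT 0 fx)) (mx κ Φ t p O.merged (gOf κ Φ t p O (KS.gT 0 gx)) (fOf κ Φ t p O (KS.fT 0 fx)))) q) (hR₁_UA κ Φ t p O.merged (gOf κ Φ t p O (KS.gT 0 gx)) (fOf κ Φ t p O (KS.fT 0 fx)) ex mx q hCq (oL κ Φ t p O.D O.DT O.ori (gOf κ Φ t p O (KS.gT 0 gx)) (fOf κ Φ t p O (KS.fT 0 fx))) hη2 t) hdiamA (hgapR_UA κ Φ t p O.merged (gOf κ Φ t p O (KS.gT 0 gx)) (fOf κ Φ t p O (KS.fT 0 fx)) ex mx q) hnL hvL (fun I => (Int.toNat_of_nonneg (nFc_RA κ Φ t p O.merged (fOf κ Φ t p O (KS.fT 0 fx)) 0 gx hNL hκ10 I).1).le) (fun I => ((nFc_RA κ Φ t p O.merged (fOf κ Φ t p O (KS.fT 0 fx)) 0 gx hNL hκ10 I).2).trans (le_of_eq (congrArg (fun y : ℤ => 3 * y) (Int.toNat_of_nonneg (nFc_RA κ Φ t p O.merged (fOf κ Φ t p O (KS.fT 0 fx)) 0 gx hNL hκ10 I).1).symm))) B hB σhF hσhF (KS.RA'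 κ Φ t p O.merged 0) qB (KS.RA' κ Φ t p O.merged 0) qB₃ qB' qB₃' hlay hRl₁ (KS.RA'_eq κ Φ t p O.merged 0).2.1.le (KS.RA'_eq κ Φ t p O.merged 0).2.1.le hB0 hRlLp hΛR hΛQ0 hΛQ1 hΛZ hkA0 hkA1 le_rfl hπ1 hclr₁ (NegB.nFA κ.K₀) hCF (NegB.nFA_le_LfA κ.K₀).1 hwideb hdwb hDwb hRb0 hEb hRbLp (fun Nr k hk j hj _ => (rootKit_levels Φ t O.merged 0 _ _ (hcoreX (KS.RA' κ Φ t p O.merged 0) qB Nr k hk) hj).1) (fun Nr k hk j hj _ => (rootKit_levels Φ t O.merged 0 _ _ (hcoreX (KS.RA' κ Φ t p O.merged 0) qB Nr k hk) hj).2.1) (fun Nr k hk j hj _ => (rootKit_levels Φ t O.merged 0 _ _ (hcoreX (KS.RA' κ Φ t p O.merged 0) qB Nr k hk) hj).2.2) (fun N₃ k hk j hj _ => (rootKit_levels Φ t O.merged 0 _ _ (hcoreY (KS.RA' κ Φ t p O.merged 0) qB₃ N₃ k hk) hj).1) (fun N₃ k hk j hj _ => (rootKit_levels Φ t O.merged 0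 _ _ (hcoreY (KS.RA' κ Φ t p O.merged 0) qB₃ N₃ k hk) hj).2.1) (fun N₃ k hk j hj _ => (rootKit_levels Φ t O.merged 0 _ _ (hcoreY (KS.RA' κ Φ t p O.merged 0) qB₃ N₃ k hk) hj).2.2) (fun Nr k hk j hj _ => (rootKit_levels Φ t O.merged 0 _ _ (hcoreY (KS.RA' κ Φ t p O.merged 0) qB' Nr k hk) hj).1) (fun Nr k hk j hj _ => (rootKit_levels Φ t O.merged 0 _ _ (hcoreY (KS.RA' κ Φ t p O.merged 0) qB' Nr k hk) hj).2.1) (fun Nr k hk j hj _ => (rootKit_levels Φ t O.merged 0 _ _ (hcoreY (KS.RA' κ Φ t p O.merged 0) qB' Nr k hk) hj).2.2) (fun N₃ k hk j hj _ => (rootKit_levels Φ t O.merged 0 _ _ (hcoreX (KS.RA' κ Φ t p O.merged 0) qB₃' N₃ k hk) hj).1) (fun N₃ k hk j hj _ => (rootKit_levels Φ t O.merged 0 _ _ (hcoreX (KS.RA' κ Φ t p O.merged 0) qB₃' N₃ k hk) hj).2.1) (fun N₃ k hk j hj _ => (rootKit_levels Φ t O.merged 0 _ _ (hcoreX (KS.RA'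 κ Φ t p O.merged 0) qB₃' N₃ k hk) hj).2.2) hRr0 (rootKit_reach κ Φ t p O.merged 0 _ _) (rootKit_reach κ Φ t p O.merged 0 _ _) hRlLp hclrz2 hRsLp hρLp hZU2 Qb Fb hQb hFb hFZ hbridge hR1b hR1r (by rw [KS.tanOff_apron]; have := (KS.le_T₀a t O.merged 0).2.2; unfold KS.j₀A; omega) (by rw [(KS.apron_fields Φ t O.merged 0 _ _).2.2.2.1]; have h := (KS.levels_wide t O.merged 0 (le_refl (KS.j₀A t O.merged 0))).2.1; have := (KS.le_T₀a t O.merged 0).2.2; unfold KS.j₀A at *; omega) (by rw [KS.shellD_apron, (KS.apron_fields Φ t O.merged 0 _ _).2.2.2.1]; have h := (KS.levels_wide t O.merged 0 (le_refl (KS.j₀A t O.merged 0))).2.2; have := (KS.le_T₀a t O.merged 0).2.2; unfold KS.j₀A at *; omega) hr0L (by rw [KS.tanOff_apron, (KS.apron_fields Φ t O.merged 0 _ _).1, (KS.apron_fields Φ t O.merged 0 _ _).2.2.2.1]; unfold KS.reachA; omega) (fun _ => (KS.vline_floors O.merged 0).2.2.1) (fun _ => (KS.layerK_of_atQOS 0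 hAtS).2.2.2) (by have := (KS.MK_facts O.merged 0).2.1; omega) (fun _ => by have := (KS.nKit_facts O.merged 0).2.2.2.2; change 2 * (2 * Mu O.merged + 12) ≤ KS.nKit O.merged 0; omega) hexitR2 hexitL2 hkC2 (KS.kkA κ Φ t p O.merged 0) (KS.hNk_at κ Φ t p O.merged 0 hp0 hp1) (KS.counts_R κ Φ t p O.merged 0 hp0 hp1 hq1 hq2 (Neg.δkit_le_δ₂ κ Φ)).1 hexitK2 numsX numsY hnFx hnFy

end NegB

end PlanarSkeletonNeg

end Summit.CriticalPhenomena.PercolationContinuityZ3.Theorems.Transplant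

end
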